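import Literature.MathematicalPhysics.QuantumFieldTheory.Balaban1983to89.B9SectBStepWhole
import Literature.MathematicalPhysics.QuantumFieldTheory.Balaban1983to89.B9Thm34SectBUniform
import Literature.MathematicalPhysics.QuantumFieldTheory.Balaban1983to89.B9Thm34HolderLeftUniform
import Literature.MathematicalPhysics.QuantumFieldTheory.Balaban1983to89.B9Thm34HolderInputGpUniform
import Literature.MathematicalPhysics.QuantumFieldTheory.Balaban1983to89.B9Ineq346L2Uniform

/-!
# `Balaban1983to89.B9SectBGpStepAtLetters` — [B9] Sect. B, the (3.42)-step for G′(U′U) (Theorem 3.4 ∕ p. 402 *"we can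
# prove all the statements (3.42)–(3.47) for the operator G′(U′U)"*) and the (3.48)-step for C⁻¹(U′U) ((3.65)–(3.67) p. 403
# *"The inverse satisfies Theorem 3.2"*) PINNED AT THE LETTERS of the tree's Sect. B programme: the letters dictionaries
# `GpFrame` ∕ `CinvFrame` and ★ `stepEPos_of_gpFrame : GpFrame … → StepEPos … Gp`, ★ `stepKerPos_of_cinvFrame : CinvFrame … → StepKerPos …`

T. Bałaban, *Propagators for lattice gauge theories in a background field*, Commun. Math. Phys. **99** (1985) 389–434
[`Balaban1985BackgroundPropagators`, "B9"]; [4] = T. Bałaban, *Propagators and renormalization transformations for lattice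
gauge theories. II*, Commun. Math. Phys. **96** (1984) 223–250 [`Balaban1984PropagatorsII`].

statement-level skeleton of published theorems with citation tags; proofs where landed; nothing here is a claim about the
Yang–Mills mass gap

THE PRINTED LOCUS (verbatim).  Theorem 3.4, p. 400: *"There exists a positive constant a₁ such that the operators G′(U),
(Q′(U)G′²(U)Q′*(U))⁻¹, R(U), G(U) extend to configurations U′U for α₁ ≦ a₁ as analytic functions of A. The extended
operators satisfy all the inequalities of Theorems 3.1–3.3 correspondingly."*; p. 402, (3.60): *"Δ′_a(U′U) = Δ′_a(U) − V′(A),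
where the operator V′(A) is defined by the last equality"*; (3.64): *"G′(U′U) = G′(U)(I − V′(A)G′(U))⁻¹ = Σ_{n=0}^∞
G′(U)(V′(A)G′(U))ⁿ"*; after (3.64): *"applying Theorem 3.1 for G′(U), the inequalities (3.63), (3.64), and Lemma 2.1 of [4]
we can prove all the statements (3.42)–(3.47) for the operator G′(U′U), of course with different constants"*.

THE POINT.  `B9SectBStepWhole` (v1.2) reduced the Sect.-B obligation `hB : B9.SectBStepPrinted …` of node N06 to twenty-four
POSITIVE-INPUT printed block-steps, each with an r06 final-level theorem behind it, and named the residual: the LETTERS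
DICTIONARY between the abstract readings `B9.KernelFamily (geo i) (bg i)` ∕ `B9.Backgrounds` of the cell's carriers and the
letters of the tree's Sect. B programme (seat r06) — operators `Module.End ℝ (S × ι → ℝ)` on the real coordinates of
𝔸-valued lattice functions (`B9Eq352DivFormLetters.conj b`), block majorants `B6RandomWalk.HasMajorant` over the block map,
the background as a lattice field `U : κ → S → 𝔸ˣ`, the exponent field `A` of (3.37), the (3.19) ∕ (3.59) ∕ (3.60) data of the
concrete `V′(A)` (`B9Eq360VprimeLetters.vPrimeConc`).  THIS FILE writes that dictionary down for ONE kernel family K (the G′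
family) as a structure `GpFrame` — its fields are EXACTLY the hypotheses of r06's uniform Theorem-3.4 clause
`B9Thm34SectBUniform.thm34_Gp_uniform` per member of the family, plus the four LAWS an operator-layer instance must prove:
(a) `G′(U)` is THE two-sided inverse of the letter `Δ′_a(U)` whenever one exists (`gop_eq`) and one exists at every
(3.35)-regular U above the thresholds (`reg_inv`, Theorem 3.11 p. 416); (b) the (3.60) law `Δ′_a(U′U) = Δ′_a(U) − V′(A)` on the
class (3.37) (`mul_law`) together with the blockwise reading of (3.37) (`cplx`); (c) READING the (3.42) entries of K at U
as block majorants of the letters `G′(U)`, `∇_{U,k}G′(U)`, `G′(U)∇_{U,k}`, `Δ_U G′(U)` (`read342`); (d) WRITING block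
majorants of the same letters of `G′(U′U)` back as the (3.42) block of K at U′U (`write342`, *"of course with different
constants"*) — and proves ★ `stepEPos_of_gpFrame`: ANY such frame inhabits the positive-input (3.42)-step
`B9SectBStepWhole.StepEPos d c35 geo bg Gp GA Cinv Gp` — by `thm34_Gp_uniform` (constants `a₁`, `B` chosen before the member),
the uniqueness of two-sided inverses (the family's own `G′(U′U)` IS r06's extension `gPrimeExtEnd G′(U) (V′(A)G′(U))` of (3.64),
since both invert `Δ′_a(U) − V′(A) = Δ′_a(U′U)`), and the frame's readings.  So the operator layer of record (NODE 00's
`OpsY` instance, def-Y's v2 `lettersYOfRecord`) discharges the (3.42)-step of `hB` for G′ by INSTANTIATING `GpFrame`.  The second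
half does the same for the kernel step (3.48): `CinvFrame` extends `GpFrame` by the (3.19) letters Q′(U), Q′*(U), the letter
C⁻¹(V) with its uniqueness ∕ existence laws, the (3.57) law Q′(U′U) = Q′(U) + F′(A) and the kernel readings, and
★ `stepKerPos_of_cinvFrame` inhabits `B9SectBStepWhole.StepKerPos` from r06's `thm34_Cinv_uniform` (rate min(δ₀, δ₁) of the
input tuple; uniqueness twice).  v1.1 adds, on the SAME letters, `GlobFrame` ∕ ★ `stepGlobPos_of_globFrame` (the (3.47) block,
written from the four (3.42)-type majorants of the extension — p. 398, `B9Ineq347AllEntries` at the letters) and `H1Frame` ∕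
★ `stepH1Pos_of_h1Frame` (the (3.43) block from r06's per-probe transfers `B9Thm34HolderLeftUniform.thm34_Gp_holderLeft_uniform` ∕
`thm34_Gp_holderRight_uniform`).  The other twenty steps want the sibling frames (same pattern over `B9Thm34GUniform`,
`B9Thm34HolderInputGpUniform`, the L² uniform files, and the G-twins).

HONEST SCOPE.  Nothing of print is asserted and no operator of [B9] is constructed: `GpFrame` ∕ `CinvFrame` are hypothesis
structures (the contract an instance meets), `thm34_Gp_uniform` ∕ `thm34_Cinv_uniform` are USED BY NAME, the theorems are
quantifier bookkeeping + uniqueness of two-sided inverses.  Output rate `wδ (9δ₀/10)` and constant `wB B (9δ₀/10)` are the frame's writing functions applied to r06's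
`(B, 9δ₀/10)`.  The frame is not shown inhabited here (its inhabitant is the operator layer of record, not in the tree);
count-neutral; NOT a node discharge; nothing continuum, nothing about the mass gap.  Cell `pub-ymgap` (HUMAN RULING D-0062),
Track A node N06 [B9], N06-ASSIGNMENT row 13, seat `pub-ymgap-dag-n06-c` (g2), 2026-08-26.
-/

noncomputable section

namespace Literature.MathematicalPhysics.QuantumFieldTheory.Balaban1983to89.B9SectBGpStepAtLetters

open Literature.MathematicalPhysics.QuantumFieldTheory.Balaban1983to89
open Literature.MathematicalPhysics.QuantumFieldTheory.Balaban1983to89.B6RandomWalk (HasMajorant hasMajorant_mono Triangle254 Ineq261)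
open Literature.MathematicalPhysics.QuantumFieldTheory.Balaban1983to89.B9Thm34Ext (toB6)
open Literature.MathematicalPhysics.QuantumFieldTheory.Balaban1983to89.B9Ineq347 (ScaleTransfer)
open Literature.MathematicalPhysics.QuantumFieldTheory.Balaban1983to89.B9Eq39Adjoint (covD covDstar)
open Literature.MathematicalPhysics.QuantumFieldTheory.Balaban1983to89.B9Eq352DivForm (tauB)
open Literature.MathematicalPhysics.QuantumFieldTheory.Balaban1983to89.B9Eq352DivFormLetters (conj)
open Literature.MathematicalPhysics.QuantumFieldTheory.Balaban1983to89.B9Eq352GradLetters (diffLetter)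
open Literature.MathematicalPhysics.QuantumFieldTheory.Balaban1983to89.B9Eq360Vprime (gPrimeExtEnd)
open Literature.MathematicalPhysics.QuantumFieldTheory.Balaban1983to89.B9Eq360VprimeLetters (vPrimeConc)
open Literature.MathematicalPhysics.QuantumFieldTheory.Balaban1983to89.B9Thm34SectBUniform (thm34_Gp_uniform thm34_Cinv_uniform)
open Literature.MathematicalPhysics.QuantumFieldTheory.Balaban1983to89.B6RandomWalkHom (HasMajorantHom)
open Literature.MathematicalPhysics.QuantumFieldTheory.Balaban1983to89.B9FromB6 (EBlock)
open Literature.MathematicalPhysics.QuantumFieldTheory.Balaban1983to89.B9SectBStepWhole (StepPos StepEPos StepKerPos)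

universe u

variable {I : Type} (d : ℕ) (c35 : ℝ) (geo : I → B9.Geometry) (bg : I → B9.Backgrounds)
  (Gp : ∀ i, B9.KernelFamily (geo i) (bg i))
  {𝔸 : Type u} [NormedRing 𝔸] [NormedAlgebra ℂ 𝔸] [CompleteSpace 𝔸] {ι : Type} [Fintype ι] [DecidableEq ι]
  (b : Module.Basis ι ℝ 𝔸) (κ : Type) [Fintype κ]
  (S : I → Type) [∀ i, Fintype (S i)] [∀ i, DecidableEq (S i)]
  [∀ i, Fintype (geo i).Site] [∀ i, DecidableEq (geo i).Site] [∀ i, Nonempty (geo i).Site]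

/-- **THE LETTERS DICTIONARY FOR THE G′ FAMILY** — the contract between the abstract family `Gp i : B9.KernelFamily (geo i) (bg i)`
(the readings (3.42) Theorem 3.1 bounds) and the letters of the tree's Sect. B programme at every member `i` of the family:
the fine lattice `S i` with shifts `T i` (p. 390), the block map `blk i` (𝔅, p. 393), the background read as a lattice field
`coord i U : κ → S i → 𝔸ˣ`, the letters `Δp i U` = Δ′_a(U) (3.24), `Gop i U` = G′(U) (3.25), `Lap i U` = Δ_U (the fourth entry
of (3.42)), the (3.19) block-averaging data `kQ sQ w` and the a-coefficients `cfun` of Δ′_a, the exponent field `expA i U U′`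
with U′ = e^{iηA} and its (3.59) data `kF sF`; the FRAME-LEVEL constants (uniform in the member, p. 399 *"the constants … do
not depend on the sequence {Ω_j}"*): `dB` ([4] (2.61)'s dimension), `Cq a₀ d₀ M₂`, the scale-transfer function `Λf` ([4] Lemma
2.1 ∕ p. 398), the reading constant `cR`, the writing functions `wB wδ`, the thresholds `MInv aInv aW`; and the LAWS: the
geometry axioms, (2.61) and the scale transfers at every rate, unitary-type background and stencil range, the (3.19) ∕ (3.24)
sizes, `gop_eq` ∕ `reg_inv` (G′(U) is the inverse of Δ′_a(U): Thm 3.11 p. 416 under (3.35)), `cplx` (the blockwise reading of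
(3.37)), `mul_law` ((3.60)), `read342` ∕ `write342` (the (3.42) entries ARE block majorants of the letters, both ways, *"of
course with different constants"* p. 403).  Field shapes = the hypotheses of `B9Thm34SectBUniform.thm34_Gp_uniform`
verbatim.  A hypothesis structure; nothing asserted.
[cite: Balaban1985BackgroundPropagators, Thm 3.4 p.400 + (3.60)–(3.64) p.402 + p.403 + Thm 3.1 (3.42) p.397 + (3.37) p.396 + (3.24)–(3.25) p.394 + (3.19) p.393 + Thm 3.11 p.416; Balaban1984PropagatorsII, Lemma 2.1 (2.61) p.234 + (2.51) p.232] -/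
structure GpFrame where
  /-- [4] (2.61)'s dimension parameter. -/
  dB : ℕ
  /-- (3.59) constant C_q, the a-coefficient bound a₀ of Δ′_a, the stencil range d₀, the real-coordinate constant M₂ of `b`. -/
  Cq : ℝ
  a₀ : ℝ
  d₀ : ℝ
  M₂ : ℝ
  /-- [4] Lemma 2.1 ∕ p. 398: the scale-transfer constant at rate δ and exponent α. -/
  Λf : ℝ → ℝ → ℝ
  /-- reading constant, writing functions (constant, rate), thresholds (M, Mα₀ for invertibility; α₁ for writing). -/
  cR : ℝ
  wB : ℝ → ℝ → ℝ
  wδ : ℝ → ℝ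
  MInv : ℝ
  aInv : ℝ
  aW : ℝ
  Cq_nonneg : 0 ≤ Cq
  a₀_nonneg : 0 ≤ a₀
  M₂_nonneg : 0 ≤ M₂
  Λf_one_le : ∀ δ α : ℝ, 0 < δ → 0 < α → 1 ≤ Λf δ α
  cR_pos : 0 < cR
  wB_pos : ∀ B δ : ℝ, 0 ≤ B → 0 < δ → 0 < wB B δ
  wδ_pos : ∀ δ : ℝ, 0 < δ → 0 < wδ δ
  MInv_pos : 0 < MInv
  aInv_pos : 0 < aInv
  aW_pos : 0 < aW
  hrepr : ∀ (v : 𝔸) (j : ι), |b.repr v j| ≤ M₂ * ‖v‖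
  /-- per member: shifts, block map, [4] (2.1)–(2.2) parameter and hypothesis, background coordinates, letters and data. -/
  T : ∀ i, κ → Equiv.Perm (S i)
  blk : ∀ i, S i → (geo i).Site
  Rr : I → ℝ
  Hp : I → Prop
  coord : ∀ i, (bg i).Cfg → κ → S i → 𝔸ˣ
  kQ : ∀ i, (bg i).Cfg → (geo i).Site → S i → 𝔸 →L[ℝ] 𝔸
  sQ : ∀ i, (bg i).Cfg → S i → 𝔸 →L[ℝ] 𝔸
  w : ∀ i, (bg i).Cfg → (geo i).Site → ℝ
  cfun : ∀ i, (geo i).Site → ℝ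
  expA : ∀ i, (bg i).Cfg → (bg i).Cfg → κ → S i → 𝔸
  kF : ∀ i, (bg i).Cfg → (bg i).Cfg → (geo i).Site → S i → 𝔸 →L[ℝ] 𝔸
  sF : ∀ i, (bg i).Cfg → (bg i).Cfg → S i → 𝔸 →L[ℝ] 𝔸
  Δp : ∀ i, (bg i).Cfg → Module.End ℝ (S i × ι → ℝ)
  Gop : ∀ i, (bg i).Cfg → Module.End ℝ (S i × ι → ℝ)
  Lap : ∀ i, (bg i).Cfg → Module.End ℝ (S i × ι → ℝ)
  /-- the multiscale geometry axioms ([4] (2.46), (2.54)) and the scales. -/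
  dist_nonneg : ∀ i (a a' : (geo i).Site), 0 ≤ (geo i).dist a a'
  triangle : ∀ i, Triangle254 (toB6 (geo i) (Rr i) (Hp i))
  dist_self : ∀ i (y : (geo i).Site), (geo i).dist y y = 0
  dist_comm : ∀ i (y y' : (geo i).Site), (geo i).dist y y' = (geo i).dist y' y
  len_pos : ∀ i (y : (geo i).Site), 0 < (geo i).len y
  eta_le_len : ∀ i (y : (geo i).Site), (geo i).eta ≤ (geo i).len y
  eta_pos : ∀ i, 0 < (geo i).eta
  /-- [4] Lemma 2.1 (2.61) and the p. 398 scale transfers, at EVERY positive rate (the step's input rate is arbitrary). -/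
  h261 : ∀ i (δ α : ℝ), 0 < δ → 0 < α → α < 1 → Ineq261 dB (toB6 (geo i) (Rr i) (Hp i)) δ α
  hST : ∀ i (δ α : ℝ), 0 < δ → 0 < α →
    ScaleTransfer (geo i) δ α (Λf δ α) (fun a => (geo i).len a) ∧ ScaleTransfer (geo i) δ α (Λf δ α) (fun a => (geo i).len a ^ 2) ∧
    ScaleTransfer (geo i) δ α (Λf δ α) (fun a => ((geo i).len a)⁻¹) ∧
    ScaleTransfer (geo i) δ α (Λf δ α) (fun a => ((geo i).len a ^ 2)⁻¹) ∧
    ScaleTransfer (geo i) δ α (Λf δ α) (fun a => ((geo i).len a ^ 4)⁻¹) ∧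
    ScaleTransfer (geo i) δ α (Λf δ α) (fun y => (geo i).len y ^ (-(4 : ℝ)))
  /-- unitary-type background, stencil range `d₀` of the shifts in the multiscale distance. -/
  unitary : ∀ i (U : (bg i).Cfg) (m : κ) (z : S i),
    ‖((coord i U m z : 𝔸ˣ) : 𝔸)‖ ≤ 1 ∧ ‖(((coord i U m z)⁻¹ : 𝔸ˣ) : 𝔸)‖ ≤ 1
  stencilB : ∀ i (μ : κ) (x : S i), (geo i).dist (blk i x) (blk i ((T i μ).symm x)) ≤ d₀
  stencilF : ∀ i (μ : κ) (x : S i), (geo i).dist (blk i x) (blk i (T i μ x)) ≤ d₀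
  stencil0 : ∀ i (y : (geo i).Site), (geo i).dist y y ≤ d₀
  /-- the A-independent (3.19) ∕ (3.24) data of the concrete V′(A) of (3.60). -/
  w_nonneg : ∀ i (U : (bg i).Cfg) (y : (geo i).Site), 0 ≤ w i U y
  card_w : ∀ i (U : (bg i).Cfg) (y : (geo i).Site), ((B9Eq360Vprime.block (blk i) y).card : ℝ) * w i U y ≤ 1
  hkQ : ∀ i (U : (bg i).Cfg) (y : (geo i).Site) (x : S i), blk i x = y → ‖kQ i U y x‖ ≤ w i U y
  hsQ : ∀ i (U : (bg i).Cfg) (x : S i), ‖sQ i U x‖ ≤ 1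
  hcfun : ∀ i (y : (geo i).Site), |cfun i y| ≤ a₀ * ((geo i).len y ^ 2)⁻¹
  /-- `G′(V)` is THE two-sided inverse of `Δ′_a(V)` whenever one exists (every configuration, complex ones included). -/
  gop_eq : ∀ i (V : (bg i).Cfg) (D X : Module.End ℝ (S i × ι → ℝ)), Δp i V = D → D * X = 1 → X * D = 1 → Gop i V = X
  /-- Theorem 3.11: at a (3.35)-regular U above the thresholds, Δ′_a(U) is invertible (G′(U) inverts it). -/
  reg_inv : ∀ i (α₀ : ℝ) (U : (bg i).Cfg), MInv ≤ (geo i).M → 0 < α₀ → (geo i).M * α₀ ≤ aInv → (bg i).Reg335 c35 α₀ U →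
    Δp i U * Gop i U = 1 ∧ Gop i U * Δp i U = 1
  /-- the class (3.37) read blockwise: U′ = e^{iηA}, A = `expA i U U′`, with the seven bounds `thm34_Gp_uniform` consumes. -/
  cplx : ∀ i (α₁ : ℝ) (U U' : (bg i).Cfg), 0 < α₁ → (bg i).Cplx337 α₁ U U' →
    (∀ (y : (geo i).Site) (x : S i), blk i x = y → ‖kF i U U' y x‖ ≤ Cq * α₁ * w i U y) ∧
    (∀ x : S i, ‖sF i U U' x‖ ≤ Cq * α₁) ∧
    (∀ (ν k : κ) (x : S i), ‖(((geo i).eta : ℂ))⁻¹ • covDstar (T i) (coord i U) ν (expA i U U' k) x‖ ≤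
      α₁ * ((geo i).len (blk i x) ^ 2)⁻¹) ∧
    (∀ (μ ν : κ) (x : S i), ‖(((geo i).eta : ℂ))⁻¹ • covD (T i) (coord i U) μ (expA i U U' ν) x‖ ≤
      α₁ * ((geo i).len (blk i x) ^ 2)⁻¹) ∧
    (∀ (μ : κ) (x : S i), ‖(((geo i).eta : ℂ))⁻¹ • covDstar (T i) (coord i U) μ (tauB (T i) (coord i U) μ (expA i U U' μ)) x‖ ≤
      α₁ * ((geo i).len (blk i x) ^ 2)⁻¹) ∧
    (∀ (k : κ) (x : S i), ‖expA i U U' k x‖ ≤ α₁ * ((geo i).len (blk i x))⁻¹) ∧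
    (∀ (ν k : κ) (x : S i), ‖tauB (T i) (coord i U) ν (expA i U U' k) x‖ ≤ α₁ * ((geo i).len (blk i x))⁻¹)
  /-- (3.60): Δ′_a(U′U) = Δ′_a(U) − V′(A) with the concrete V′(A) of the tree's Sect. B programme. -/
  mul_law : ∀ i (α₁ : ℝ) (U U' : (bg i).Cfg), 0 < α₁ → (bg i).Cplx337 α₁ U U' →
    Δp i ((bg i).mul U' U) = Δp i U -
      conj b (vPrimeConc (T i) (coord i U) (geo i).eta (expA i U U') (blk i) (kQ i U) (kF i U U') (sQ i U) (sF i U U') (cfun i))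
  /-- READING: the (3.42) block of K at U with (B₀, δ) ⇒ block majorants of the four letters of G′(U) with (cR·B₀, δ). -/
  read342 : ∀ i (α₀ : ℝ) (U : (bg i).Cfg) (B₀ δ : ℝ), MInv ≤ (geo i).M → 0 < α₀ → (geo i).M * α₀ ≤ aInv →
    (bg i).Reg335 c35 α₀ U → 0 < B₀ → 0 < δ → EBlock (Gp i) B₀ δ U →
    HasMajorant (g := toB6 (geo i) (Rr i) (Hp i)) (fun p : S i × ι => blk i p.1) (Gop i U)
        (fun a a' => cR * B₀ * (geo i).len a ^ 2 * Real.exp (-(δ * (geo i).dist a a'))) ∧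
      (∀ k : κ ⊕ κ, HasMajorant (g := toB6 (geo i) (Rr i) (Hp i)) (fun p : S i × ι => blk i p.1)
        (conj b (diffLetter (T i) (coord i U) ((((geo i).eta : ℂ))⁻¹) k) * Gop i U)
        (fun a a' => cR * B₀ * (geo i).len a * Real.exp (-(δ * (geo i).dist a a')))) ∧
      (∀ k : κ ⊕ κ, HasMajorant (g := toB6 (geo i) (Rr i) (Hp i)) (fun p : S i × ι => blk i p.1)
        (Gop i U * conj b (diffLetter (T i) (coord i U) ((((geo i).eta : ℂ))⁻¹) k))
        (fun a a' => cR * B₀ * (geo i).len a * Real.exp (-(δ * (geo i).dist a a')))) ∧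
      HasMajorant (g := toB6 (geo i) (Rr i) (Hp i)) (fun p : S i × ι => blk i p.1) (Lap i U * Gop i U)
        (fun a a' => cR * B₀ * 1 * Real.exp (-(δ * (geo i).dist a a')))
  /-- WRITING: block majorants of the four letters of G′(U′U) (letters ∇_{U,k}, Δ_U at the real U) with (B, δ) ⇒ the
  (3.42) block of K at U′U with (wB B δ, wδ δ), for U′ in the class (3.37) at α₁ ≤ aW. -/
  write342 : ∀ i (U U' : (bg i).Cfg) (α₁ B δ : ℝ), 0 < α₁ → α₁ ≤ aW → (bg i).Cplx337 α₁ U U' → 0 ≤ B → 0 < δ →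
    HasMajorant (g := toB6 (geo i) (Rr i) (Hp i)) (fun p : S i × ι => blk i p.1) (Gop i ((bg i).mul U' U))
        (fun a a' => B * (geo i).len a ^ 2 * Real.exp (-(δ * (geo i).dist a a'))) →
    (∀ k : κ ⊕ κ, HasMajorant (g := toB6 (geo i) (Rr i) (Hp i)) (fun p : S i × ι => blk i p.1)
        (conj b (diffLetter (T i) (coord i U) ((((geo i).eta : ℂ))⁻¹) k) * Gop i ((bg i).mul U' U))
        (fun a a' => B * (geo i).len a * Real.exp (-(δ * (geo i).dist a a')))) →
    (∀ k : κ ⊕ κ, HasMajorant (g := toB6 (geo i) (Rr i) (Hp i)) (fun p : S i × ι => blk i p.1)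
        (Gop i ((bg i).mul U' U) * conj b (diffLetter (T i) (coord i U) ((((geo i).eta : ℂ))⁻¹) k))
        (fun a a' => B * (geo i).len a * Real.exp (-(δ * (geo i).dist a a')))) →
    HasMajorant (g := toB6 (geo i) (Rr i) (Hp i)) (fun p : S i × ι => blk i p.1) (Lap i U * Gop i ((bg i).mul U' U))
        (fun a a' => B * 1 * Real.exp (-(δ * (geo i).dist a a'))) →
    EBlock (Gp i) (wB B δ) (wδ δ) ((bg i).mul U' U)

variable {d c35 geo bg Gp b κ S}

/-- ★ **THE (3.42)-STEP OF SECT. B FOR G′(U′U), INHABITED AT THE LETTERS**: every letters dictionary `GpFrame` for the family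
`Gp` inhabits the positive-input block-step `B9SectBStepWhole.StepEPos d c35 geo bg Gp GA Cinv Gp` (for any companion
families `GA`, `Cinv` of the leaf).  Proof = r06's `B9Thm34SectBUniform.thm34_Gp_uniform` at the input rate δ₀ and sup
constant cR·B₀ (its `a₁`, `B` are chosen BEFORE the member — the step's constants are uniform in `i`), the uniqueness of
two-sided inverses (the family's `G′(U′U)` inverts `Δ′_a(U′U) = Δ′_a(U) − V′(A)` (3.60), as does r06's extension
`gPrimeExtEnd G′(U) (V′(A)G′(U))` of (3.64) — so they coincide, `gop_eq`), and the frame's readings (3.42) ↔ block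
majorants.  Thresholds: M ≧ MInv, Mα₀ ≦ aInv (invertibility at U), α₁ ≦ min(a₁, aW); output constants
(wB B (9δ₀/10), wδ (9δ₀/10)).  Nothing of print asserted beyond what `thm34_Gp_uniform` proves.
[cite: Balaban1985BackgroundPropagators, Thm 3.4 p.400 + (3.60)–(3.65) p.402 + p.403 + Thm 3.1 (3.42) p.397 + Thm 3.11 p.416; Balaban1984PropagatorsII, Lemma 2.1 p.234] -/
theorem stepEPos_of_gpFrame (F : GpFrame c35 geo bg Gp b κ S)
    (GA : ∀ i, B9.KernelFamily (geo i) (bg i)) (Cinv : ∀ i, B9.SiteKernel (geo i) (bg i)) :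
    StepEPos d c35 geo bg Gp GA Cinv Gp := by
  intro B₀ δ₀ Bβ Bε Bεβ B₁ δ₁ hB₀ hδ₀ _ _
  -- r06's uniform Theorem-3.4 clause for G′, at the input rate δ₀ and the read sup constant cR·B₀
  obtain ⟨a₁, ha₁, B, hB, H⟩ := thm34_Gp_uniform b κ F.dB δ₀ (F.cR * B₀) F.Cq F.a₀ F.d₀ F.M₂ (F.Λf δ₀)
    (mul_pos F.cR_pos hB₀) F.Cq_nonneg F.a₀_nonneg F.M₂_nonneg hδ₀ (fun α hα => F.Λf_one_le δ₀ α hδ₀ hα) F.hrepr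
  have hδ' : 0 < 9 / 10 * δ₀ := by positivity
  refine ⟨F.MInv, min a₁ F.aW, F.aInv, (F.wB B (9 / 10 * δ₀), F.wδ (9 / 10 * δ₀)), F.MInv_pos, lt_min ha₁ F.aW_pos,
    F.aInv_pos, ⟨F.wB_pos B _ hB hδ', F.wδ_pos _ hδ'⟩, ?_⟩
  intro i hM α₀ hα₀ hMa U hU hT α₁ hα₁ ha U' hU'
  -- G′(U) inverts Δ′_a(U); the (3.42) entries of G′(U) read as block majorants; (3.37) read blockwise
  obtain ⟨hΔG, hGΔ⟩ := F.reg_inv i α₀ U hM hα₀ hMa hU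
  obtain ⟨h1, h2, h3, hL⟩ := F.read342 i α₀ U B₀ δ₀ hM hα₀ hMa hU hB₀ hδ₀ hT.1.1.1
  obtain ⟨hkF, hsF, h337s, h337F, h337B, hA, hAτ⟩ := F.cplx i α₁ U U' hα₁ hU'
  obtain ⟨hinv1, hinv2, hleft, hright⟩ := H (F.T i) (F.coord i U) (F.blk i) (F.kQ i U) (F.sQ i U) (F.cfun i) (F.w i U)
    (F.dist_nonneg i) (F.triangle i) (F.dist_self i) (F.dist_comm i) (F.len_pos i) (F.eta_le_len i) (F.eta_pos i)
    (fun α hα hα1 => F.h261 i δ₀ α hδ₀ hα hα1) (fun α hα => F.hST i δ₀ α hδ₀ hα) (F.unitary i U)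
    (F.stencilB i) (F.stencilF i) (F.stencil0 i) (F.w_nonneg i U) (F.card_w i U) (F.hkQ i U) (F.hsQ i U) (F.hcfun i)
    hΔG hGΔ h1 h2 h3 α₁ hα₁.le (le_trans ha (min_le_left _ _)) (F.expA i U U') (F.kF i U U') (F.sF i U U')
    hkF hsF h337s h337F h337B hA hAτ
  -- the family's G′(U′U) IS r06's extension (3.64): both are two-sided inverses of Δ′_a(U) − V′(A) = Δ′_a(U′U) (3.60)
  have hG := F.gop_eq i ((bg i).mul U' U) _ _ (F.mul_law i α₁ U U' hα₁ hU') hinv1 hinv2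
  rw [← hG] at hleft hright
  -- the four entries of G′(U′U) at (B, 9δ₀/10), written back as the (3.42) block of the family at U′U
  have e0 : HasMajorant (g := toB6 (geo i) (F.Rr i) (F.Hp i)) (fun p : S i × ι => F.blk i p.1)
      (1 * F.Gop i ((bg i).mul U' U))
      (fun a a' => B * (geo i).len a ^ 2 * Real.exp (-(9 / 10 * δ₀ * (geo i).dist a a'))) :=
    hleft 1 (fun a => (geo i).len a ^ 2) (fun a => sq_nonneg _) (by simpa only [one_mul] using h1)
  rw [one_mul] at e0
  exact F.write342 i U U' α₁ B (9 / 10 * δ₀) hα₁ (le_trans ha (min_le_right _ _)) hU' hB hδ' e0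
    (fun k => hleft _ (fun a => (geo i).len a) (fun a => (F.len_pos i a).le) (h2 k))
    (fun k => hright _ (h3 k)) (hleft _ (fun _ => (1 : ℝ)) (fun _ => zero_le_one) hL)

/-! ## The C⁻¹ = (Q′G′²Q′*)⁻¹ clause: (3.65)–(3.67) p. 403 *"The inverse satisfies Theorem 3.2"* — the (3.48)-step at the letters -/

/-- Rate bookkeeping for block majorants: a majorant `c·P(a)·e^{−δd}` with `c·P ≧ 0` stays one at any smaller rate `δ′ ≦ δ`
(d ≧ 0). [folklore] -/
private theorem hasMajorant_rate_le {g : B6.Geometry} {X : Type} (blk : X → g.Site) {T : Module.End ℝ (X → ℝ)}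
    {c δ δ' : ℝ} (P : g.Site → ℝ) (hc : ∀ a, 0 ≤ c * P a) (hδ : δ' ≤ δ) (hd : ∀ a a' : g.Site, 0 ≤ g.dist a a')
    (h : HasMajorant blk T (fun a a' => c * P a * Real.exp (-(δ * g.dist a a')))) :
    HasMajorant blk T (fun a a' => c * P a * Real.exp (-(δ' * g.dist a a'))) :=
  hasMajorant_mono blk h fun a a' =>
    mul_le_mul_of_nonneg_left (Real.exp_le_exp.2 (by nlinarith [hd a a', hδ])) (hc a)

variable (d c35 geo bg Gp b κ S) in
/-- **THE LETTERS DICTIONARY FOR THE PAIR (G′, C⁻¹)** — `GpFrame` extended by the (3.19) letters Q′(U), Q′*(U) as Hom letters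
between the fine lattice and 𝔅 (`Qc`, `Qcs`, block-local majorants κ_Q, [4] (2.51)), the letter `Cop i V` = C⁻¹(V) =
(Q′(V)G′(V)²Q′*(V))⁻¹ (3.21) as an operator on 𝔅-functions with its laws `cop_eq` (it is THE two-sided inverse whenever one
exists) and `reg_cinv` ((3.21) exists at (3.35)-regular U above the thresholds, Thm 3.2 ∕ 3.11), the (3.57) law `q_mul`:
Q′(U′U) = Q′(U) + F′(A), Q′*(U′U) = Q′*(U) + F′*(A) with the (3.59) majorants c_F·α₁ (`hF`), and the kernel readings of the
family `Cinv i` against `B9Thm34Inv.ker (vol g dB)` both ways (`readKer` ∕ `writeKer`, kernel reading constant `cK`, writing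
functions `wK`, `wKδ`).  Field shapes = the hypotheses of `B9Thm34SectBUniform.thm34_Cinv_uniform` verbatim.  A hypothesis
structure; nothing asserted. [cite: Balaban1985BackgroundPropagators, Thm 3.2 (3.48) p.398 + (3.19)–(3.21) pp.393–394 + (3.57)–(3.59) p.402 + (3.65)–(3.67) p.403 + Thm 3.11 p.416; Balaban1984PropagatorsII, (2.51) p.232] -/
structure CinvFrame (Cinv : ∀ i, B9.SiteKernel (geo i) (bg i)) extends GpFrame c35 geo bg Gp b κ S where
  κQ : ℝ
  cF : ℝ
  cK : ℝ
  wK : ℝ → ℝ → ℝ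
  wKδ : ℝ → ℝ
  κQ_pos : 0 < κQ
  cF_pos : 0 < cF
  cK_pos : 0 < cK
  wK_pos : ∀ B δ : ℝ, 0 ≤ B → 0 < δ → 0 < wK B δ
  wKδ_pos : ∀ δ : ℝ, 0 < δ → 0 < wKδ δ
  Qc : ∀ i, (bg i).Cfg → (S i × ι → ℝ) →ₗ[ℝ] ((geo i).Site → ℝ)
  Qcs : ∀ i, (bg i).Cfg → ((geo i).Site → ℝ) →ₗ[ℝ] (S i × ι → ℝ)
  Cop : ∀ i, (bg i).Cfg → Module.End ℝ ((geo i).Site → ℝ)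
  Fc : ∀ i, (bg i).Cfg → (bg i).Cfg → (S i × ι → ℝ) →ₗ[ℝ] ((geo i).Site → ℝ)
  Fcs : ∀ i, (bg i).Cfg → (bg i).Cfg → ((geo i).Site → ℝ) →ₗ[ℝ] (S i × ι → ℝ)
  /-- (3.19): Q′(U), Q′*(U) are block-local with entries ≦ κ_Q. -/
  hQc : ∀ i (U : (bg i).Cfg), HasMajorantHom (g := toB6 (geo i) (Rr i) (Hp i)) (fun p : S i × ι => blk i p.1)
    (fun y : (geo i).Site => y) (Qc i U) (fun a a' : (geo i).Site => κQ * (if a = a' then (1 : ℝ) else 0))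
  hQcs : ∀ i (U : (bg i).Cfg), HasMajorantHom (g := toB6 (geo i) (Rr i) (Hp i)) (fun y : (geo i).Site => y)
    (fun p : S i × ι => blk i p.1) (Qcs i U) (fun a a' : (geo i).Site => κQ * (if a = a' then (1 : ℝ) else 0))
  /-- `C⁻¹(V)` is THE two-sided inverse of `Q′(V)G′(V)²Q′*(V)` whenever one exists (every configuration). -/
  cop_eq : ∀ i (V : (bg i).Cfg) (D X : Module.End ℝ ((geo i).Site → ℝ)),
    Qc i V ∘ₗ (Gop i V * Gop i V) ∘ₗ Qcs i V = D → X * D = 1 → D * X = 1 → Cop i V = X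
  /-- (3.21) at a (3.35)-regular U above the thresholds: C(U)·C⁻¹(U) = 1 (Thm 3.2 ∕ 3.11). -/
  reg_cinv : ∀ i (α₀ : ℝ) (U : (bg i).Cfg), MInv ≤ (geo i).M → 0 < α₀ → (geo i).M * α₀ ≤ aInv → (bg i).Reg335 c35 α₀ U →
    (Qc i U ∘ₗ (Gop i U * Gop i U) ∘ₗ Qcs i U) * Cop i U = 1
  /-- (3.57): Q′(U′U) = Q′(U) + F′(A), Q′*(U′U) = Q′*(U) + F′*(A) on the class (3.37). -/
  q_mul : ∀ i (α₁ : ℝ) (U U' : (bg i).Cfg), 0 < α₁ → (bg i).Cplx337 α₁ U U' →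
    Qc i ((bg i).mul U' U) = Qc i U + Fc i U U' ∧ Qcs i ((bg i).mul U' U) = Qcs i U + Fcs i U U'
  /-- (3.59): the variations F′(A), F′*(A) are block-local with entries ≦ c_F·α₁. -/
  hF : ∀ i (α₁ : ℝ) (U U' : (bg i).Cfg), 0 < α₁ → (bg i).Cplx337 α₁ U U' →
    HasMajorantHom (g := toB6 (geo i) (Rr i) (Hp i)) (fun p : S i × ι => blk i p.1) (fun y : (geo i).Site => y) (Fc i U U')
        (fun a a' : (geo i).Site => cF * α₁ * (if a = a' then (1 : ℝ) else 0)) ∧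
      HasMajorantHom (g := toB6 (geo i) (Rr i) (Hp i)) (fun y : (geo i).Site => y) (fun p : S i × ι => blk i p.1) (Fcs i U U')
        (fun a a' : (geo i).Site => cF * α₁ * (if a = a' then (1 : ℝ) else 0))
  /-- READING (3.48): the kernel bound of `Cinv i` at U with (B₁, δ) ⇒ the kernel bound of the letter C⁻¹(U) with (cK·B₁, δ). -/
  readKer : ∀ i (α₀ : ℝ) (U : (bg i).Cfg) (B₁ δ : ℝ), MInv ≤ (geo i).M → 0 < α₀ → (geo i).M * α₀ ≤ aInv →
    (bg i).Reg335 c35 α₀ U → 0 < B₁ → 0 < δ →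
    (∀ y y' : (geo i).Site, |(Cinv i).ker U y y'| ≤
      B₁ * ((geo i).len y) ^ (-(4 : ℝ)) * ((geo i).len y') ^ (-(dB : ℝ)) * Real.exp (-(δ * (geo i).dist y y'))) →
    ∀ y y' : (geo i).Site, |B9Thm34Inv.ker (B9Thm34Inv.vol (geo i) dB) (Cop i U) y y'| ≤
      cK * B₁ * (geo i).len y ^ (-(4 : ℝ)) * (geo i).len y' ^ (-(dB : ℝ)) * Real.exp (-(δ * (geo i).dist y y'))
  /-- WRITING (3.48): the kernel bound of C⁻¹(U′U) with (B, δ) ⇒ that of `Cinv i` at U′U with (wK B δ, wKδ δ), U′ in (3.37) at α₁ ≦ aW. -/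
  writeKer : ∀ i (U U' : (bg i).Cfg) (α₁ B δ : ℝ), 0 < α₁ → α₁ ≤ aW → (bg i).Cplx337 α₁ U U' → 0 ≤ B → 0 < δ →
    (∀ y y' : (geo i).Site, |B9Thm34Inv.ker (B9Thm34Inv.vol (geo i) dB) (Cop i ((bg i).mul U' U)) y y'| ≤
      B * (geo i).len y ^ (-(4 : ℝ)) * (geo i).len y' ^ (-(dB : ℝ)) * Real.exp (-(δ * (geo i).dist y y'))) →
    ∀ y y' : (geo i).Site, |(Cinv i).ker ((bg i).mul U' U) y y'| ≤
      wK B δ * ((geo i).len y) ^ (-(4 : ℝ)) * ((geo i).len y') ^ (-(dB : ℝ)) * Real.exp (-(wKδ δ * (geo i).dist y y'))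

/-- ★ **THE (3.48)-STEP OF SECT. B FOR C⁻¹(U′U), INHABITED AT THE LETTERS** ((3.65)–(3.67) p. 403: *"The inverse satisfies
Theorem 3.2"*): every letters dictionary `CinvFrame` for the pair (Gp, Cinv) inhabits the positive-input kernel step
`B9SectBStepWhole.StepKerPos F.dB c35 geo bg Gp GA Cinv Cinv` (kernel exponent = the frame's dimension `dB`).  Proof = r06's
`thm34_Cinv_uniform` at the rate min(δ₀, δ₁) of the input tuple (G′ letters read at δ₀, the kernel at δ₁, both lowered),
`thm34_Gp_uniform` for the two-sided inverse identities of the extension, uniqueness twice (`gop_eq`: the family's G′(U′U) is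
r06's extension; `cop_eq`: the family's C⁻¹(U′U) is r06's inverse `Tinv` of Q′(U′U)G′(U′U)²Q′*(U′U), since
Q′(U′U) = Q′(U) + F′(A) by `q_mul`), and the kernel readings.  Thresholds: M ≧ MInv, Mα₀ ≦ aInv, α₁ ≦ min(a₁, a₁′, aW); output
(wK B′ (9δ/25), wKδ (9δ/25)) with B′ = 2·cK·B₁·c₁(2δ/5, 1/10), δ = min(δ₀, δ₁).  Nothing of print asserted beyond what r06's
two theorems prove. [cite: Balaban1985BackgroundPropagators, Thm 3.4 p.400 + (3.65)–(3.67) p.403 + Thm 3.2 (3.48) p.398 + (3.57)–(3.60) p.402 + Thm 3.11 p.416; Balaban1984PropagatorsII, Lemma 2.1 (2.61) p.234] -/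
theorem stepKerPos_of_cinvFrame {Cinv : ∀ i, B9.SiteKernel (geo i) (bg i)} (F : CinvFrame c35 geo bg Gp b κ S Cinv)
    (GA : ∀ i, B9.KernelFamily (geo i) (bg i)) :
    StepKerPos F.dB c35 geo bg Gp GA Cinv Cinv := by
  intro B₀ δ₀ Bβ Bε Bεβ B₁ δ₁ hB₀ hδ₀ hB₁ hδ₁
  have hδ : 0 < min δ₀ δ₁ := lt_min hδ₀ hδ₁
  -- r06's uniform clauses at the rate δ := min(δ₀, δ₁): G′ (for the inverse identities) and C⁻¹
  obtain ⟨a₁, ha₁, B, -, H⟩ := thm34_Gp_uniform b κ F.dB (min δ₀ δ₁) (F.cR * B₀) F.Cq F.a₀ F.d₀ F.M₂ (F.Λf (min δ₀ δ₁))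
    (mul_pos F.cR_pos hB₀) F.Cq_nonneg F.a₀_nonneg F.M₂_nonneg hδ (fun α hα => F.Λf_one_le _ α hδ hα) F.hrepr
  obtain ⟨a₂, ha₂, H'⟩ := thm34_Cinv_uniform b κ F.dB (min δ₀ δ₁) F.κQ (F.cR * B₀) (F.cK * B₁) F.cF F.Cq F.a₀ F.d₀ F.M₂
    (F.Λf (min δ₀ δ₁)) F.κQ_pos (mul_pos F.cR_pos hB₀) (mul_pos F.cK_pos hB₁) F.cF_pos F.Cq_nonneg F.a₀_nonneg F.M₂_nonneg
    hδ (fun α hα => F.Λf_one_le _ α hδ hα) F.hrepr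
  have hδ' : 0 < 9 / 25 * min δ₀ δ₁ := by positivity
  have hB' : 0 ≤ 2 * (F.cK * B₁) * B6.c1 F.dB (2 / 5 * min δ₀ δ₁) (1 / 10) :=
    mul_nonneg (mul_nonneg zero_le_two (mul_pos F.cK_pos hB₁).le) (B6RandomWalk.c1_nonneg _ _ _)
  refine ⟨F.MInv, min (min a₁ a₂) F.aW, F.aInv,
    (F.wK (2 * (F.cK * B₁) * B6.c1 F.dB (2 / 5 * min δ₀ δ₁) (1 / 10)) (9 / 25 * min δ₀ δ₁), F.wKδ (9 / 25 * min δ₀ δ₁)),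
    F.MInv_pos, lt_min (lt_min ha₁ ha₂) F.aW_pos, F.aInv_pos, ⟨F.wK_pos _ _ hB' hδ', F.wKδ_pos _ hδ'⟩, ?_⟩
  intro i hM α₀ hα₀ hMa U hU hT α₁ hα₁ ha U' hU'
  have ha1 : α₁ ≤ a₁ := le_trans ha (le_trans (min_le_left _ _) (min_le_left _ _))
  have ha2 : α₁ ≤ a₂ := le_trans ha (le_trans (min_le_left _ _) (min_le_right _ _))
  have haW : α₁ ≤ F.aW := le_trans ha (min_le_right _ _)
  -- the letters at U: G′(U) inverts Δ′_a(U); (3.42)₀,₁,₂ at δ₀ lowered to min(δ₀, δ₁); the kernel (3.48) at δ₁ lowered likewise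
  obtain ⟨hΔG, hGΔ⟩ := F.reg_inv i α₀ U hM hα₀ hMa hU
  obtain ⟨h1, h2, h3, -⟩ := F.read342 i α₀ U B₀ δ₀ hM hα₀ hMa hU hB₀ hδ₀ hT.1.1.1
  have hc2 : ∀ a : (geo i).Site, 0 ≤ F.cR * B₀ * (geo i).len a ^ 2 :=
    fun a => mul_nonneg (mul_pos F.cR_pos hB₀).le (sq_nonneg _)
  have hc1 : ∀ a : (geo i).Site, 0 ≤ F.cR * B₀ * (geo i).len a :=
    fun a => mul_nonneg (mul_pos F.cR_pos hB₀).le (F.len_pos i a).le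
  have h1' := hasMajorant_rate_le (g := toB6 (geo i) (F.Rr i) (F.Hp i)) (fun p : S i × ι => F.blk i p.1)
    (fun a => (geo i).len a ^ 2) hc2 (min_le_left δ₀ δ₁) (F.dist_nonneg i) h1
  have h2' := fun k => hasMajorant_rate_le (g := toB6 (geo i) (F.Rr i) (F.Hp i)) (fun p : S i × ι => F.blk i p.1)
    (fun a => (geo i).len a) hc1 (min_le_left δ₀ δ₁) (F.dist_nonneg i) (h2 k)
  have h3' := fun k => hasMajorant_rate_le (g := toB6 (geo i) (F.Rr i) (F.Hp i)) (fun p : S i × ι => F.blk i p.1)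
    (fun a => (geo i).len a) hc1 (min_le_left δ₀ δ₁) (F.dist_nonneg i) (h3 k)
  have hK := F.readKer i α₀ U B₁ δ₁ hM hα₀ hMa hU hB₁ hδ₁ hT.2.1
  have hK' : ∀ y y' : (geo i).Site, |B9Thm34Inv.ker (B9Thm34Inv.vol (geo i) F.dB) (F.Cop i U) y y'| ≤
      F.cK * B₁ * (geo i).len y ^ (-(4 : ℝ)) * (geo i).len y' ^ (-(F.dB : ℝ)) *
        Real.exp (-(min δ₀ δ₁ * (geo i).dist y y')) := by
    intro y y'
    refine (hK y y').trans (mul_le_mul_of_nonneg_left (Real.exp_le_exp.2 ?_) ?_)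
    · nlinarith [F.dist_nonneg i y y', min_le_right δ₀ δ₁]
    · exact mul_nonneg (mul_nonneg (mul_pos F.cK_pos hB₁).le (Real.rpow_nonneg (F.len_pos i y).le _))
        (Real.rpow_nonneg (F.len_pos i y').le _)
  obtain ⟨hkF, hsF, h337s, h337F, h337B, hA, hAτ⟩ := F.cplx i α₁ U U' hα₁ hU'
  obtain ⟨hQm, hQsm⟩ := F.q_mul i α₁ U U' hα₁ hU'
  obtain ⟨hFc, hFcs⟩ := F.hF i α₁ U U' hα₁ hU'
  -- the G′ clause: the inverse identities of the extension ⇒ the family's G′(U′U) is r06's extension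
  obtain ⟨hinv1, hinv2, -, -⟩ := H (F.T i) (F.coord i U) (F.blk i) (F.kQ i U) (F.sQ i U) (F.cfun i) (F.w i U)
    (F.dist_nonneg i) (F.triangle i) (F.dist_self i) (F.dist_comm i) (F.len_pos i) (F.eta_le_len i) (F.eta_pos i)
    (fun α hα hα1 => F.h261 i _ α hδ hα hα1) (fun α hα => F.hST i _ α hδ hα) (F.unitary i U)
    (F.stencilB i) (F.stencilF i) (F.stencil0 i) (F.w_nonneg i U) (F.card_w i U) (F.hkQ i U) (F.hsQ i U) (F.hcfun i)
    hΔG hGΔ h1' h2' h3' α₁ hα₁.le ha1 (F.expA i U U') (F.kF i U U') (F.sF i U U')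
    hkF hsF h337s h337F h337B hA hAτ
  have hG := F.gop_eq i ((bg i).mul U' U) _ _ (F.mul_law i α₁ U U' hα₁ hU') hinv1 hinv2
  -- the C⁻¹ clause: r06's inverse of Q′(U′U)G′(U′U)²Q′*(U′U) with its kernel bound
  obtain ⟨Tinv, hT1, hT2, hker⟩ := H' (F.T i) (F.coord i U) (F.blk i) (F.kQ i U) (F.sQ i U) (F.cfun i) (F.w i U)
    (F.dist_nonneg i) (F.triangle i) (F.dist_self i) (F.dist_comm i) (F.len_pos i) (F.eta_le_len i) (F.eta_pos i)
    (fun α hα hα1 => F.h261 i _ α hδ hα hα1) (fun α hα => F.hST i _ α hδ hα) (F.unitary i U)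
    (F.stencilB i) (F.stencilF i) (F.stencil0 i) (F.w_nonneg i U) (F.card_w i U) (F.hkQ i U) (F.hsQ i U) (F.hcfun i)
    h1' h2' (F.hQc i U) (F.hQcs i U) (F.reg_cinv i α₀ U hM hα₀ hMa hU) hK' α₁ hα₁.le ha2
    (F.expA i U U') (F.kF i U U') (F.sF i U U') hkF hsF h337s hA hAτ hQm hQsm hFc hFcs
  rw [← hG] at hT1 hT2
  have hC := F.cop_eq i ((bg i).mul U' U) _ Tinv rfl hT1 hT2
  rw [← hC] at hker
  exact F.writeKer i U U' α₁ _ _ hα₁ haW hU' hB' hδ' hker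


/-! ## (v1.1) The (3.47) global block and the (3.43) Hölder block of G′(U′U) at the letters

Two more frames on the SAME letters (`GpFrame`): the global block (3.47) is written from the same four (3.42)-type majorants
of G′(U′U) (p. 398: *"the global inequalities (3.47) are consequences of the local ones (3.42) and Lemma 2.1"* — at the
letters this is `B9Ineq347AllEntries`, applied by the instance inside `writeGlob`), and the Hölder block (3.43) from r06's
PER-PROBE transfers `B9Thm34HolderLeftUniform.thm34_Gp_holderLeft_uniform` ∕ `thm34_Gp_holderRight_uniform` (derivative on
the left ∕ on the right; a probe = a left or right letter `D`, a real-linear functional `Φ` of the 𝔸-valued output, an anchor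
block `y ∋ p₀`, an exponent β and sizes `B_h, c_ζ`), handed to the instance as the single field `h1_transfer`. -/

/-- **The (3.42) entries of G′(U′U) at the letters** — the common core of the (3.42)- and (3.47)-steps: for every input
(B₀, δ₀) > 0 there are `a₁ > 0`, `B ≧ 0` (before the member) such that at every (3.35)-regular U above the thresholds with the
(3.42) block of the family at (B₀, δ₀), and every U′ in (3.37) at α₁ ≦ a₁, the family's `G′(U′U)` carries the four majorants
(entry, left differences, right differences, Laplacian letter) at (B, 9δ₀/10).  (`thm34_Gp_uniform` + `gop_eq` ∘ `mul_law`.)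
[cite: Balaban1985BackgroundPropagators, Thm 3.4 p.400 + (3.60)–(3.65) p.402 + Thm 3.1 (3.42) p.397] -/
theorem entries342_ext_of_gpFrame (F : GpFrame c35 geo bg Gp b κ S) {B₀ δ₀ : ℝ} (hB₀ : 0 < B₀) (hδ₀ : 0 < δ₀) :
    ∃ a₁ : ℝ, 0 < a₁ ∧ ∃ B : ℝ, 0 ≤ B ∧
      ∀ (i : I) (α₀ : ℝ) (U : (bg i).Cfg), F.MInv ≤ (geo i).M → 0 < α₀ → (geo i).M * α₀ ≤ F.aInv →
        (bg i).Reg335 c35 α₀ U → EBlock (Gp i) B₀ δ₀ U →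
        ∀ (α₁ : ℝ) (U' : (bg i).Cfg), 0 < α₁ → α₁ ≤ a₁ → (bg i).Cplx337 α₁ U U' →
          HasMajorant (g := toB6 (geo i) (F.Rr i) (F.Hp i)) (fun p : S i × ι => F.blk i p.1) (F.Gop i ((bg i).mul U' U))
              (fun a a' => B * (geo i).len a ^ 2 * Real.exp (-(9 / 10 * δ₀ * (geo i).dist a a'))) ∧
            (∀ k : κ ⊕ κ, HasMajorant (g := toB6 (geo i) (F.Rr i) (F.Hp i)) (fun p : S i × ι => F.blk i p.1)
              (conj b (diffLetter (F.T i) (F.coord i U) ((((geo i).eta : ℂ))⁻¹) k) * F.Gop i ((bg i).mul U' U))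
              (fun a a' => B * (geo i).len a * Real.exp (-(9 / 10 * δ₀ * (geo i).dist a a')))) ∧
            (∀ k : κ ⊕ κ, HasMajorant (g := toB6 (geo i) (F.Rr i) (F.Hp i)) (fun p : S i × ι => F.blk i p.1)
              (F.Gop i ((bg i).mul U' U) * conj b (diffLetter (F.T i) (F.coord i U) ((((geo i).eta : ℂ))⁻¹) k))
              (fun a a' => B * (geo i).len a * Real.exp (-(9 / 10 * δ₀ * (geo i).dist a a')))) ∧
            HasMajorant (g := toB6 (geo i) (F.Rr i) (F.Hp i)) (fun p : S i × ι => F.blk i p.1)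
              (F.Lap i U * F.Gop i ((bg i).mul U' U)) (fun a a' => B * 1 * Real.exp (-(9 / 10 * δ₀ * (geo i).dist a a'))) := by
  obtain ⟨a₁, ha₁, B, hB, H⟩ := thm34_Gp_uniform b κ F.dB δ₀ (F.cR * B₀) F.Cq F.a₀ F.d₀ F.M₂ (F.Λf δ₀)
    (mul_pos F.cR_pos hB₀) F.Cq_nonneg F.a₀_nonneg F.M₂_nonneg hδ₀ (fun α hα => F.Λf_one_le δ₀ α hδ₀ hα) F.hrepr
  refine ⟨a₁, ha₁, B, hB, ?_⟩
  intro i α₀ U hM hα₀ hMa hU hE α₁ U' hα₁ ha hU'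
  obtain ⟨hΔG, hGΔ⟩ := F.reg_inv i α₀ U hM hα₀ hMa hU
  obtain ⟨h1, h2, h3, hL⟩ := F.read342 i α₀ U B₀ δ₀ hM hα₀ hMa hU hB₀ hδ₀ hE
  obtain ⟨hkF, hsF, h337s, h337F, h337B, hA, hAτ⟩ := F.cplx i α₁ U U' hα₁ hU'
  obtain ⟨hinv1, hinv2, hleft, hright⟩ := H (F.T i) (F.coord i U) (F.blk i) (F.kQ i U) (F.sQ i U) (F.cfun i) (F.w i U)
    (F.dist_nonneg i) (F.triangle i) (F.dist_self i) (F.dist_comm i) (F.len_pos i) (F.eta_le_len i) (F.eta_pos i)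
    (fun α hα hα1 => F.h261 i δ₀ α hδ₀ hα hα1) (fun α hα => F.hST i δ₀ α hδ₀ hα) (F.unitary i U)
    (F.stencilB i) (F.stencilF i) (F.stencil0 i) (F.w_nonneg i U) (F.card_w i U) (F.hkQ i U) (F.hsQ i U) (F.hcfun i)
    hΔG hGΔ h1 h2 h3 α₁ hα₁.le ha (F.expA i U U') (F.kF i U U') (F.sF i U U')
    hkF hsF h337s h337F h337B hA hAτ
  have hG := F.gop_eq i ((bg i).mul U' U) _ _ (F.mul_law i α₁ U U' hα₁ hU') hinv1 hinv2
  rw [← hG] at hleft hright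
  have e0 : HasMajorant (g := toB6 (geo i) (F.Rr i) (F.Hp i)) (fun p : S i × ι => F.blk i p.1)
      (1 * F.Gop i ((bg i).mul U' U))
      (fun a a' => B * (geo i).len a ^ 2 * Real.exp (-(9 / 10 * δ₀ * (geo i).dist a a'))) :=
    hleft 1 (fun a => (geo i).len a ^ 2) (fun a => sq_nonneg _) (by simpa only [one_mul] using h1)
  rw [one_mul] at e0
  exact ⟨e0, fun k => hleft _ (fun a => (geo i).len a) (fun a => (F.len_pos i a).le) (h2 k),
    fun k => hright _ (h3 k), hleft _ (fun _ => (1 : ℝ)) (fun _ => zero_le_one) hL⟩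

variable (c35 geo bg Gp b κ S) in
/-- **THE LETTERS DICTIONARY FOR THE GLOBAL BLOCK (3.47) OF G′** — `GpFrame` plus the writing of the four (3.42)-type majorants of
`G′(U′U)` as the (3.47) block of the family at U′U (the instance's (3.47)-from-(3.42) reading, p. 398, at the letters
`B9Ineq347AllEntries`; writing function `wG`).  A hypothesis structure; nothing asserted.
[cite: Balaban1985BackgroundPropagators, (3.47) p.398 + p.402; Balaban1984PropagatorsII, Lemma 2.1 p.234] -/
structure GlobFrame extends GpFrame c35 geo bg Gp b κ S where
  wG : ℝ → ℝ → ℝ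
  wG_pos : ∀ B δ : ℝ, 0 ≤ B → 0 < δ → 0 < wG B δ
  /-- WRITING (3.47): the four majorants of G′(U′U) at (B, δ) ⇒ the (3.47) block of the family at U′U with constant `wG B δ`. -/
  writeGlob : ∀ i (U U' : (bg i).Cfg) (α₁ B δ : ℝ), 0 < α₁ → α₁ ≤ aW → (bg i).Cplx337 α₁ U U' → 0 ≤ B → 0 < δ →
    HasMajorant (g := toB6 (geo i) (Rr i) (Hp i)) (fun p : S i × ι => blk i p.1) (Gop i ((bg i).mul U' U))
        (fun a a' => B * (geo i).len a ^ 2 * Real.exp (-(δ * (geo i).dist a a'))) →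
    (∀ k : κ ⊕ κ, HasMajorant (g := toB6 (geo i) (Rr i) (Hp i)) (fun p : S i × ι => blk i p.1)
        (conj b (diffLetter (T i) (coord i U) ((((geo i).eta : ℂ))⁻¹) k) * Gop i ((bg i).mul U' U))
        (fun a a' => B * (geo i).len a * Real.exp (-(δ * (geo i).dist a a')))) →
    (∀ k : κ ⊕ κ, HasMajorant (g := toB6 (geo i) (Rr i) (Hp i)) (fun p : S i × ι => blk i p.1)
        (Gop i ((bg i).mul U' U) * conj b (diffLetter (T i) (coord i U) ((((geo i).eta : ℂ))⁻¹) k))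
        (fun a a' => B * (geo i).len a * Real.exp (-(δ * (geo i).dist a a')))) →
    HasMajorant (g := toB6 (geo i) (Rr i) (Hp i)) (fun p : S i × ι => blk i p.1) (Lap i U * Gop i ((bg i).mul U' U))
        (fun a a' => B * 1 * Real.exp (-(δ * (geo i).dist a a'))) →
    B9FromB6.GlobBlock (Gp i) (wG B δ) ((bg i).mul U' U)

/-- ★ **THE (3.47)-STEP OF SECT. B FOR G′(U′U), INHABITED AT THE LETTERS**: every `GlobFrame` inhabits
`B9SectBStepWhole.StepGlobPos d c35 geo bg Gp GA Cinv Gp` (output constant `wG B (9δ₀/10)`), by `entries342_ext_of_gpFrame` and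
the frame's (3.47) writing. [cite: Balaban1985BackgroundPropagators, Thm 3.4 p.400 + (3.47) p.398 + p.402] -/
theorem stepGlobPos_of_globFrame (F : GlobFrame c35 geo bg Gp b κ S)
    (GA : ∀ i, B9.KernelFamily (geo i) (bg i)) (Cinv : ∀ i, B9.SiteKernel (geo i) (bg i)) :
    B9SectBStepWhole.StepGlobPos d c35 geo bg Gp GA Cinv Gp := by
  intro B₀ δ₀ Bβ Bε Bεβ B₁ δ₁ hB₀ hδ₀ _ _
  obtain ⟨a₁, ha₁, B, hB, H⟩ := entries342_ext_of_gpFrame F.toGpFrame hB₀ hδ₀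
  have hδ' : 0 < 9 / 10 * δ₀ := by positivity
  refine ⟨F.MInv, min a₁ F.aW, F.aInv, F.wG B (9 / 10 * δ₀), F.MInv_pos, lt_min ha₁ F.aW_pos, F.aInv_pos,
    F.wG_pos B _ hB hδ', ?_⟩
  intro i hM α₀ hα₀ hMa U hU hT α₁ hα₁ ha U' hU'
  obtain ⟨e0, e1, e2, e3⟩ := H i α₀ U hM hα₀ hMa hU hT.1.1.1 α₁ U' hα₁ (le_trans ha (min_le_left _ _)) hU'
  exact F.writeGlob i U U' α₁ B (9 / 10 * δ₀) hα₁ (le_trans ha (min_le_right _ _)) hU' hB hδ' e0 e1 e2 e3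

variable (c35 geo bg Gp b κ S) in
/-- **THE LETTERS DICTIONARY FOR THE HÖLDER BLOCK (3.43) OF G′** — `GpFrame` plus ONE transfer field: given the (3.42) and (3.43)
blocks of the family at U and r06's two PER-PROBE Hölder transfers for the family's own `G′(U′U)` (derivative on the left: for
every left letter `D`, functional `Φ`, anchor `y ∋ p₀`, exponent β, sizes `B_h, c_ζ ≧ 0`, the probe bound for `G′(U)` implies
the probe bound for `G′(U′U)` with `B_L·B_h` at rate 9δ/10; derivative on the right: the same for right letters `D` with a
(3.42)₃-type entry, from the three probe bounds (a) (b) (c)), the (3.43) block of the family holds at U′U with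
(`wH B_L B_R δ B₀(·)`, `wHδ δ`).  The probes are the instance's Hölder difference quotients (3.40); nothing asserted.
[cite: Balaban1985BackgroundPropagators, (3.43) p.398 + (3.40) p.397 + p.402; Balaban1984PropagatorsII, (2.51) p.232] -/
structure H1Frame extends GpFrame c35 geo bg Gp b κ S where
  wH : ℝ → ℝ → ℝ → (ℝ → ℝ) → (ℝ → ℝ)
  wHδ : ℝ → ℝ
  wHδ_pos : ∀ δ : ℝ, 0 < δ → 0 < wHδ δ
  /-- THE TRANSFER: r06's per-probe (3.43) transfers (left and right) for `G′(U′U)` ⇒ the (3.43) block of the family at U′U. -/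
  h1_transfer : ∀ i (α₀ : ℝ) (U U' : (bg i).Cfg) (α₁ B₀ BL BR δ : ℝ) (Bβ : ℝ → ℝ),
    MInv ≤ (geo i).M → 0 < α₀ → (geo i).M * α₀ ≤ aInv → (bg i).Reg335 c35 α₀ U →
    0 < α₁ → α₁ ≤ aW → (bg i).Cplx337 α₁ U U' → 0 < B₀ → 0 ≤ BL → 0 ≤ BR → 0 < δ →
    EBlock (Gp i) B₀ δ U → B9FromB6.H1Block (Gp i) Bβ δ U →
    -- r06's left transfer, for every probe
    (∀ (D : Module.End ℝ (S i × ι → ℝ)) (Φ : (S i → 𝔸) →ₗ[ℝ] 𝔸) (y : (geo i).Site) (p₀ : S i × ι), blk i p₀.1 = y →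
      ∀ (β Bh cζ : ℝ), 0 ≤ Bh → 0 ≤ cζ →
        (∀ (y' : (geo i).Site) (μ : S i × ι → ℝ) (M : ℝ),
          B6RandomWalk.BlockSupp (g := toB6 (geo i) (Rr i) (Hp i)) (fun p : S i × ι => blk i p.1) μ y' M →
          ‖Φ ((B9Eq352DivFormLetters.coordEquiv b).symm (D (Gop i U μ)))‖ ≤
            Bh * (geo i).len y ^ (1 - β) * cζ * Real.exp (-(δ * (geo i).dist y y')) * M) →
        ∀ (y' : (geo i).Site) (μ : S i × ι → ℝ) (M : ℝ),
          B6RandomWalk.BlockSupp (g := toB6 (geo i) (Rr i) (Hp i)) (fun p : S i × ι => blk i p.1) μ y' M →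
          ‖Φ ((B9Eq352DivFormLetters.coordEquiv b).symm (D (Gop i ((bg i).mul U' U) μ)))‖ ≤
            BL * Bh * (geo i).len y ^ (1 - β) * cζ * Real.exp (-(9 / 10 * δ * (geo i).dist y y')) * M) →
    -- r06's right transfer, for every right letter with a (3.42)₃-type entry and every probe
    (∀ (D : Module.End ℝ (S i × ι → ℝ)),
      HasMajorant (g := toB6 (geo i) (Rr i) (Hp i)) (fun p : S i × ι => blk i p.1) (Gop i U * D)
        (fun a a' => cR * B₀ * (geo i).len a * Real.exp (-(δ * (geo i).dist a a'))) →
      ∀ (Φ : (S i → 𝔸) →ₗ[ℝ] 𝔸) (y : (geo i).Site) (p₀ : S i × ι), blk i p₀.1 = y →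
      ∀ (β Bh cζ : ℝ), 0 ≤ Bh → 0 ≤ cζ →
        (∀ (y' : (geo i).Site) (μ : S i × ι → ℝ) (M : ℝ),
          B6RandomWalk.BlockSupp (g := toB6 (geo i) (Rr i) (Hp i)) (fun p : S i × ι => blk i p.1) μ y' M →
          ‖Φ ((B9Eq352DivFormLetters.coordEquiv b).symm (Gop i U μ))‖ ≤
            Bh * (geo i).len y ^ (2 - β) * cζ * Real.exp (-(δ * (geo i).dist y y')) * M) →
        (∀ (k : κ ⊕ κ) (y' : (geo i).Site) (μ : S i × ι → ℝ) (M : ℝ),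
          B6RandomWalk.BlockSupp (g := toB6 (geo i) (Rr i) (Hp i)) (fun p : S i × ι => blk i p.1) μ y' M →
          ‖Φ ((B9Eq352DivFormLetters.coordEquiv b).symm
              ((Gop i U * conj b (diffLetter (T i) (coord i U) ((((geo i).eta : ℂ))⁻¹) k)) μ))‖ ≤
            Bh * (geo i).len y ^ (1 - β) * cζ * Real.exp (-(δ * (geo i).dist y y')) * M) →
        (∀ (y' : (geo i).Site) (μ : S i × ι → ℝ) (M : ℝ),
          B6RandomWalk.BlockSupp (g := toB6 (geo i) (Rr i) (Hp i)) (fun p : S i × ι => blk i p.1) μ y' M →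
          ‖Φ ((B9Eq352DivFormLetters.coordEquiv b).symm ((Gop i U * D) μ))‖ ≤
            Bh * (geo i).len y ^ (1 - β) * cζ * Real.exp (-(δ * (geo i).dist y y')) * M) →
        ∀ (y' : (geo i).Site) (μ : S i × ι → ℝ) (M : ℝ),
          B6RandomWalk.BlockSupp (g := toB6 (geo i) (Rr i) (Hp i)) (fun p : S i × ι => blk i p.1) μ y' M →
          ‖Φ ((B9Eq352DivFormLetters.coordEquiv b).symm ((Gop i ((bg i).mul U' U) * D) μ))‖ ≤
            BR * Bh * (geo i).len y ^ (1 - β) * cζ * Real.exp (-(9 / 10 * δ * (geo i).dist y y')) * M) →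
    B9FromB6.H1Block (Gp i) (wH BL BR δ Bβ) (wHδ δ) ((bg i).mul U' U)

/-- ★ **THE (3.43)-STEP OF SECT. B FOR G′(U′U), INHABITED AT THE LETTERS**: every `H1Frame` inhabits
`B9SectBStepWhole.StepH1Pos d c35 geo bg Gp GA Cinv Gp` (outputs `wH B_L B_R δ₀ B₀(·)`, `wHδ δ₀`).  Proof: r06's
`thm34_Gp_holderLeft_uniform` and `thm34_Gp_holderRight_uniform` (constants `a₁, B_L`, `a₁′, B_R` before the member) plus
`thm34_Gp_uniform` for the inverse identities that identify the family's `G′(U′U)` with r06's extension (`gop_eq`), then the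
frame's transfer field. [cite: Balaban1985BackgroundPropagators, Thm 3.4 p.400 + Thm 3.1 (3.43) p.398 + (3.60)–(3.65) pp.402–403; Balaban1984PropagatorsII, Lemma 2.1 p.234] -/
theorem stepH1Pos_of_h1Frame (F : H1Frame c35 geo bg Gp b κ S)
    (GA : ∀ i, B9.KernelFamily (geo i) (bg i)) (Cinv : ∀ i, B9.SiteKernel (geo i) (bg i)) :
    B9SectBStepWhole.StepH1Pos d c35 geo bg Gp GA Cinv Gp := by
  intro B₀ δ₀ Bβ Bε Bεβ B₁ δ₁ hB₀ hδ₀ _ _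
  have hBG : 0 < F.cR * B₀ := mul_pos F.cR_pos hB₀
  obtain ⟨aE, haE, BE, -, HE⟩ := thm34_Gp_uniform b κ F.dB δ₀ (F.cR * B₀) F.Cq F.a₀ F.d₀ F.M₂ (F.Λf δ₀)
    hBG F.Cq_nonneg F.a₀_nonneg F.M₂_nonneg hδ₀ (fun α hα => F.Λf_one_le δ₀ α hδ₀ hα) F.hrepr
  obtain ⟨aL, haL, BL, hBL, HL⟩ := B9Thm34HolderLeftUniform.thm34_Gp_holderLeft_uniform b κ F.dB δ₀ (F.cR * B₀) F.Cq F.a₀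
    F.d₀ F.M₂ (F.Λf δ₀) hBG F.Cq_nonneg F.a₀_nonneg F.M₂_nonneg hδ₀ (fun α hα => F.Λf_one_le δ₀ α hδ₀ hα) F.hrepr
  obtain ⟨aR, haR, BR, hBR, HR⟩ := B9Thm34HolderLeftUniform.thm34_Gp_holderRight_uniform b κ F.dB δ₀ (F.cR * B₀) F.Cq F.a₀
    F.d₀ F.M₂ (F.Λf δ₀) hBG F.Cq_nonneg F.a₀_nonneg F.M₂_nonneg hδ₀ (fun α hα => F.Λf_one_le δ₀ α hδ₀ hα) F.hrepr
  refine ⟨F.MInv, min (min aE (min aL aR)) F.aW, F.aInv, (F.wH BL BR δ₀ Bβ, F.wHδ δ₀), F.MInv_pos,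
    lt_min (lt_min haE (lt_min haL haR)) F.aW_pos, F.aInv_pos, F.wHδ_pos _ hδ₀, ?_⟩
  intro i hM α₀ hα₀ hMa U hU hT α₁ hα₁ ha U' hU'
  have haE' : α₁ ≤ aE := le_trans ha (le_trans (min_le_left _ _) (min_le_left _ _))
  have haL' : α₁ ≤ aL := le_trans ha (le_trans (min_le_left _ _) (le_trans (min_le_right _ _) (min_le_left _ _)))
  have haR' : α₁ ≤ aR := le_trans ha (le_trans (min_le_left _ _) (le_trans (min_le_right _ _) (min_le_right _ _)))
  have haW : α₁ ≤ F.aW := le_trans ha (min_le_right _ _)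
  obtain ⟨hΔG, hGΔ⟩ := F.reg_inv i α₀ U hM hα₀ hMa hU
  obtain ⟨h1, h2, h3, -⟩ := F.read342 i α₀ U B₀ δ₀ hM hα₀ hMa hU hB₀ hδ₀ hT.1.1.1
  obtain ⟨hkF, hsF, h337s, h337F, h337B, hA, hAτ⟩ := F.cplx i α₁ U U' hα₁ hU'
  -- the inverse identities ⇒ the family's G′(U′U) is r06's extension
  obtain ⟨hinv1, hinv2, -, -⟩ := HE (F.T i) (F.coord i U) (F.blk i) (F.kQ i U) (F.sQ i U) (F.cfun i) (F.w i U)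
    (F.dist_nonneg i) (F.triangle i) (F.dist_self i) (F.dist_comm i) (F.len_pos i) (F.eta_le_len i) (F.eta_pos i)
    (fun α hα hα1 => F.h261 i δ₀ α hδ₀ hα hα1) (fun α hα => F.hST i δ₀ α hδ₀ hα) (F.unitary i U)
    (F.stencilB i) (F.stencilF i) (F.stencil0 i) (F.w_nonneg i U) (F.card_w i U) (F.hkQ i U) (F.hsQ i U) (F.hcfun i)
    hΔG hGΔ h1 h2 h3 α₁ hα₁.le haE' (F.expA i U U') (F.kF i U U') (F.sF i U U')
    hkF hsF h337s h337F h337B hA hAτ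
  have hG := F.gop_eq i ((bg i).mul U' U) _ _ (F.mul_law i α₁ U U' hα₁ hU') hinv1 hinv2
  -- r06's two per-probe Hölder transfers at this member, background and exponent field
  have HL' := HL (F.T i) (F.coord i U) (F.blk i) (F.kQ i U) (F.sQ i U) (F.cfun i) (F.w i U)
    (F.dist_nonneg i) (F.triangle i) (F.dist_self i) (F.dist_comm i) (F.len_pos i) (F.eta_le_len i) (F.eta_pos i)
    (fun α hα hα1 => F.h261 i δ₀ α hδ₀ hα hα1) (fun α hα => F.hST i δ₀ α hδ₀ hα) (F.unitary i U)
    (F.stencilB i) (F.stencilF i) (F.stencil0 i) (F.w_nonneg i U) (F.card_w i U) (F.hkQ i U) (F.hsQ i U) (F.hcfun i)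
    hΔG hGΔ h1 h2 h3 α₁ hα₁.le haL' (F.expA i U U') (F.kF i U U') (F.sF i U U')
    hkF hsF h337s h337F h337B hA hAτ
  have HR' := HR (F.T i) (F.coord i U) (F.blk i) (F.kQ i U) (F.sQ i U) (F.cfun i) (F.w i U)
    (F.dist_nonneg i) (F.triangle i) (F.dist_self i) (F.dist_comm i) (F.len_pos i) (F.eta_le_len i) (F.eta_pos i)
    (fun α hα hα1 => F.h261 i δ₀ α hδ₀ hα hα1) (fun α hα => F.hST i δ₀ α hδ₀ hα) (F.unitary i U)
    (F.stencilB i) (F.stencilF i) (F.stencil0 i) (F.w_nonneg i U) (F.card_w i U) (F.hkQ i U) (F.hsQ i U) (F.hcfun i)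
    hΔG hGΔ h1 h2 h3 α₁ hα₁.le haR' (F.expA i U U') (F.kF i U U') (F.sF i U U')
    hkF hsF h337s h337F h337B hA hAτ
  rw [← hG] at HL' HR'
  exact F.h1_transfer i α₀ U U' α₁ B₀ BL BR δ₀ Bβ hM hα₀ hMa hU hα₁ haW hU' hB₀ hBL hBR hδ₀ hT.1.1.1 hT.1.2.1 HL' HR'


/-! ## (v1.2) The input-Hölder blocks (3.44) ∕ (3.45) of G′(U′U) at the letters

The same letters once more; r06's `B9Thm34HolderInputGpUniform.thm34_Gp_holderInput_uniform` transfers, PER INPUT (a pair of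
letters `D_l`, `D_s` with (3.42)₂ ∕ (3.42)₃-type entries, a block-supported `μ` with bound `M`, the (3.44) datum `N` of the
unperturbed G′(U)) and PER PROBE (`Φ`, anchor, exponent, sizes; the (3.45) datum `N₂`), the (3.44)- and (3.45)-type members
from G′(U) to G′(U′U) («of course with different constants»); the instance turns the family of these transfers for ITS inputs
and probes into the (3.44) ∕ (3.45) blocks of the family at U′U — the single field `e4h2_transfer`. -/

variable (c35 geo bg Gp b κ S) in
/-- **THE LETTERS DICTIONARY FOR THE INPUT-HÖLDER BLOCKS (3.44) ∕ (3.45) OF G′** — `GpFrame` plus ONE transfer field: given the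
(3.42) and (3.43)–(3.45) blocks of the family at U and r06's per-input ∕ per-probe transfers (v′) (sup output) and (vi′) (Hölder
output) for the family's own `G′(U′U)`, the (3.44) and (3.45) blocks of the family hold at U′U with (`wE4 B δ B′₀(·)`, `wHδ′ δ`)
and (`wH2 B δ B₀(·) B′₀(·,·)`, `wHδ′ δ`).  Field shapes = the conclusions (v′), (vi′) of `thm34_Gp_holderInput_uniform` verbatim.
A hypothesis structure; nothing asserted. [cite: Balaban1985BackgroundPropagators, (3.44)–(3.45) p.398 + (3.40) p.397 + (3.65) p.402 + p.403 l.2–5; Balaban1984PropagatorsII, (2.51)–(2.52) p.232 + Lemma 2.1 p.234] -/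
structure E4H2Frame extends GpFrame c35 geo bg Gp b κ S where
  wE4 : ℝ → ℝ → (ℝ → ℝ) → (ℝ → ℝ)
  wH2 : ℝ → ℝ → (ℝ → ℝ) → (ℝ → ℝ → ℝ) → (ℝ → ℝ → ℝ)
  wHδ' : ℝ → ℝ
  wHδ'_pos : ∀ δ : ℝ, 0 < δ → 0 < wHδ' δ
  /-- THE TRANSFER: r06's per-input (v′) and per-probe (vi′) input-Hölder transfers for `G′(U′U)` ⇒ the (3.44), (3.45) blocks at U′U. -/
  e4h2_transfer : ∀ i (α₀ : ℝ) (U U' : (bg i).Cfg) (α₁ B₀ B δ : ℝ) (Bβ Bε : ℝ → ℝ) (Bεβ : ℝ → ℝ → ℝ),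
    MInv ≤ (geo i).M → 0 < α₀ → (geo i).M * α₀ ≤ aInv → (bg i).Reg335 c35 α₀ U →
    0 < α₁ → α₁ ≤ aW → (bg i).Cplx337 α₁ U U' → 0 < B₀ → 0 ≤ B → 0 < δ →
    EBlock (Gp i) B₀ δ U → B9.Ineq343_345 (Gp i) Bβ Bε Bεβ δ U →
    -- (v′) the (3.44)-type member, per pair of letters and per input
    (∀ (Dl Ds : Module.End ℝ (S i × ι → ℝ)),
      HasMajorant (g := toB6 (geo i) (Rr i) (Hp i)) (fun p : S i × ι => blk i p.1) (Dl * Gop i U)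
        (fun a a' => cR * B₀ * (geo i).len a * Real.exp (-(δ * (geo i).dist a a'))) →
      HasMajorant (g := toB6 (geo i) (Rr i) (Hp i)) (fun p : S i × ι => blk i p.1) (Gop i U * Ds)
        (fun a a' => cR * B₀ * (geo i).len a * Real.exp (-(δ * (geo i).dist a a'))) →
      ∀ (y' : (geo i).Site) (μ : S i × ι → ℝ) (M : ℝ),
        B6RandomWalk.BlockSupp (g := toB6 (geo i) (Rr i) (Hp i)) (fun p : S i × ι => blk i p.1) μ y' M →
      ∀ (N : ℝ), 0 ≤ N →
        (∀ (k : κ ⊕ κ) (z : S i × ι),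
          |(((conj b (diffLetter (T i) (coord i U) ((((geo i).eta : ℂ))⁻¹) k)) * Gop i U * Ds) μ) z| ≤
            N * Real.exp (-(δ * (geo i).dist (blk i z.1) y'))) →
        (∀ z : S i × ι, |((Dl * Gop i U * Ds) μ) z| ≤ N * Real.exp (-(δ * (geo i).dist (blk i z.1) y'))) →
        ∀ x : S i × ι, |((Dl * Gop i ((bg i).mul U' U) * Ds) μ) x| ≤
          B * (N + M) * Real.exp (-(4 / 5 * δ * (geo i).dist (blk i x.1) y'))) →
    -- (vi′) the (3.45)-type member, per pair of letters, per probe and per input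
    (∀ (Dl Ds : Module.End ℝ (S i × ι → ℝ)),
      HasMajorant (g := toB6 (geo i) (Rr i) (Hp i)) (fun p : S i × ι => blk i p.1) (Dl * Gop i U)
        (fun a a' => cR * B₀ * (geo i).len a * Real.exp (-(δ * (geo i).dist a a'))) →
      HasMajorant (g := toB6 (geo i) (Rr i) (Hp i)) (fun p : S i × ι => blk i p.1) (Gop i U * Ds)
        (fun a a' => cR * B₀ * (geo i).len a * Real.exp (-(δ * (geo i).dist a a'))) →
      ∀ (Φ : (S i → 𝔸) →ₗ[ℝ] 𝔸) (y : (geo i).Site) (p₀ : S i × ι), blk i p₀.1 = y →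
      ∀ (γ Bh cζ : ℝ), 0 ≤ Bh → 0 ≤ cζ →
        (∀ (y'' : (geo i).Site) (ν : S i × ι → ℝ) (C : ℝ),
          B6RandomWalk.BlockSupp (g := toB6 (geo i) (Rr i) (Hp i)) (fun p : S i × ι => blk i p.1) ν y'' C →
          ‖Φ ((B9Eq352DivFormLetters.coordEquiv b).symm (Dl (Gop i U ν)))‖ ≤
            Bh * (geo i).len y ^ (1 - γ) * cζ * Real.exp (-(δ * (geo i).dist y y'')) * C) →
      ∀ (y' : (geo i).Site) (μ : S i × ι → ℝ) (M : ℝ),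
        B6RandomWalk.BlockSupp (g := toB6 (geo i) (Rr i) (Hp i)) (fun p : S i × ι => blk i p.1) μ y' M →
      ∀ (N : ℝ), 0 ≤ N →
        (∀ (k : κ ⊕ κ) (z : S i × ι),
          |(((conj b (diffLetter (T i) (coord i U) ((((geo i).eta : ℂ))⁻¹) k)) * Gop i U * Ds) μ) z| ≤
            N * Real.exp (-(δ * (geo i).dist (blk i z.1) y'))) →
      ∀ (N₂ : ℝ), 0 ≤ N₂ →
        ‖Φ ((B9Eq352DivFormLetters.coordEquiv b).symm ((Dl * Gop i U * Ds) μ))‖ ≤ N₂ * Real.exp (-(δ * (geo i).dist y y')) →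
        ‖Φ ((B9Eq352DivFormLetters.coordEquiv b).symm ((Dl * Gop i ((bg i).mul U' U) * Ds) μ))‖ ≤
          B * (N₂ + Bh * (geo i).len y ^ (1 - γ) * cζ * ((geo i).len y)⁻¹ * (N + M)) *
            Real.exp (-(4 / 5 * δ * (geo i).dist y y'))) →
    B9FromB6.E4Block (Gp i) (wE4 B δ Bε) (wHδ' δ) ((bg i).mul U' U) ∧
      B9FromB6.H2Block (Gp i) (wH2 B δ Bβ Bεβ) (wHδ' δ) ((bg i).mul U' U)

/-- The two input-Hölder blocks of G′(U′U) at the letters, in one positive-input step (product of outputs).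
[cite: Balaban1985BackgroundPropagators, Thm 3.4 p.400 + (3.44)–(3.45) p.398 + (3.65) p.402] -/
theorem stepE4H2Pos_of_e4h2Frame (F : E4H2Frame c35 geo bg Gp b κ S)
    (GA : ∀ i, B9.KernelFamily (geo i) (bg i)) (Cinv : ∀ i, B9.SiteKernel (geo i) (bg i)) :
    StepPos d c35 geo bg Gp GA Cinv (((ℝ → ℝ) × ℝ) × ((ℝ → ℝ → ℝ) × ℝ)) (fun c => 0 < c.1.2 ∧ 0 < c.2.2)
      (fun c i U α₁ => ∀ U' : (bg i).Cfg, (bg i).Cplx337 α₁ U U' →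
        B9FromB6.E4Block (Gp i) c.1.1 c.1.2 ((bg i).mul U' U) ∧ B9FromB6.H2Block (Gp i) c.2.1 c.2.2 ((bg i).mul U' U)) := by
  intro B₀ δ₀ Bβ Bε Bεβ B₁ δ₁ hB₀ hδ₀ _ _
  have hBG : 0 < F.cR * B₀ := mul_pos F.cR_pos hB₀
  obtain ⟨a₁, ha₁, B, hB, H⟩ := B9Thm34HolderInputGpUniform.thm34_Gp_holderInput_uniform b κ F.dB δ₀ (F.cR * B₀) F.Cq F.a₀
    F.d₀ F.M₂ (F.Λf δ₀) hBG F.Cq_nonneg F.a₀_nonneg F.M₂_nonneg hδ₀ (fun α hα => F.Λf_one_le δ₀ α hδ₀ hα) F.hrepr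
  refine ⟨F.MInv, min a₁ F.aW, F.aInv, ((F.wE4 B δ₀ Bε, F.wHδ' δ₀), (F.wH2 B δ₀ Bβ Bεβ, F.wHδ' δ₀)), F.MInv_pos,
    lt_min ha₁ F.aW_pos, F.aInv_pos, ⟨F.wHδ'_pos _ hδ₀, F.wHδ'_pos _ hδ₀⟩, ?_⟩
  intro i hM α₀ hα₀ hMa U hU hT α₁ hα₁ ha U' hU'
  obtain ⟨hΔG, hGΔ⟩ := F.reg_inv i α₀ U hM hα₀ hMa hU
  obtain ⟨h1, h2, h3, -⟩ := F.read342 i α₀ U B₀ δ₀ hM hα₀ hMa hU hB₀ hδ₀ hT.1.1.1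
  obtain ⟨hkF, hsF, h337s, h337F, h337B, hA, hAτ⟩ := F.cplx i α₁ U U' hα₁ hU'
  obtain ⟨hinv1, hinv2, hv, hvi⟩ := H (F.T i) (F.coord i U) (F.blk i) (F.kQ i U) (F.sQ i U) (F.cfun i) (F.w i U)
    (F.dist_nonneg i) (F.triangle i) (F.dist_self i) (F.dist_comm i) (F.len_pos i) (F.eta_le_len i) (F.eta_pos i)
    (fun α hα hα1 => F.h261 i δ₀ α hδ₀ hα hα1) (fun α hα => F.hST i δ₀ α hδ₀ hα) (F.unitary i U)
    (F.stencilB i) (F.stencilF i) (F.stencil0 i) (F.w_nonneg i U) (F.card_w i U) (F.hkQ i U) (F.hsQ i U) (F.hcfun i)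
    hΔG hGΔ h1 h2 h3 α₁ hα₁.le (le_trans ha (min_le_left _ _)) (F.expA i U U') (F.kF i U U') (F.sF i U U')
    hkF hsF h337s h337F h337B hA hAτ
  have hG := F.gop_eq i ((bg i).mul U' U) _ _ (F.mul_law i α₁ U U' hα₁ hU') hinv1 hinv2
  rw [← hG] at hv hvi
  exact F.e4h2_transfer i α₀ U U' α₁ B₀ B δ₀ Bβ Bε Bεβ hM hα₀ hMa hU hα₁ (le_trans ha (min_le_right _ _)) hU' hB₀ hB hδ₀
    hT.1.1.1 hT.1.2 hv hvi

/-- ★ **THE (3.44)-STEP OF SECT. B FOR G′(U′U), INHABITED AT THE LETTERS** (projection of `stepE4H2Pos_of_e4h2Frame`).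
[cite: Balaban1985BackgroundPropagators, Thm 3.4 p.400 + (3.44) p.398 + p.403 l.2–5] -/
theorem stepE4Pos_of_e4h2Frame (F : E4H2Frame c35 geo bg Gp b κ S)
    (GA : ∀ i, B9.KernelFamily (geo i) (bg i)) (Cinv : ∀ i, B9.SiteKernel (geo i) (bg i)) :
    B9SectBStepWhole.StepE4Pos d c35 geo bg Gp GA Cinv Gp :=
  StepPos.mono (fun c => c.1) (fun _ h => h.1) (fun _ _ _ _ _ h U' hU' => (h U' hU').1) (stepE4H2Pos_of_e4h2Frame F GA Cinv)

/-- ★ **THE (3.45)-STEP OF SECT. B FOR G′(U′U), INHABITED AT THE LETTERS** (projection of `stepE4H2Pos_of_e4h2Frame`).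
[cite: Balaban1985BackgroundPropagators, Thm 3.4 p.400 + (3.45) p.398 + p.403 l.2–5] -/
theorem stepH2Pos_of_e4h2Frame (F : E4H2Frame c35 geo bg Gp b κ S)
    (GA : ∀ i, B9.KernelFamily (geo i) (bg i)) (Cinv : ∀ i, B9.SiteKernel (geo i) (bg i)) :
    B9SectBStepWhole.StepH2Pos d c35 geo bg Gp GA Cinv Gp :=
  StepPos.mono (fun c => c.2) (fun _ h => h.2) (fun _ _ _ _ _ h U' hU' => (h U' hU').2) (stepE4H2Pos_of_e4h2Frame F GA Cinv)


/-! ## (v1.2) The L² members (3.46)₁,₂,₃,₅ of G′(U′U) at the letters — WITH THE KERNEL-FORM INPUT DISPLAYED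

LOCATED (seat `pub-ymgap-dag-n06-c` g2, 2026-08-26): the (3.46) members of the leaf's conclusion at U′U are NOT derivable from
the leaf's own hypotheses (`B9.Thms31to33IneqAt … U`: the SUP ∕ Hölder ∕ L² readings of Theorems 3.1–3.3 at U) by the printed ∕
r06 route — the tree's L² transfers (`B9Ineq346L2Uniform.thm34_Gp_l2_uniform` and its siblings) take THEOREM 3.1 FOR G′(U) IN THE
PRINTED KERNEL FORM ([4] (2.64)–(2.66): `|G′(x,x′)| ≦ B(Lʲη)²(L^{j′}η)^{−d}e^{−δd(y,y′)}`, `B6RandomWalkKernel.HasKernelBound`) as input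
(Schur's test on block pairs), which is strictly stronger than the sup form the cell's `B9.KernelFamily.e` carries.  The frame below
therefore carries that input as a NAMED LAW `ker31` — «Theorem 3.1 for the family's G′(U) in kernel form at every (3.35)-regular U
above the thresholds, with frame-level constants (B_K, δ_K)» — which is N06 CONTENT (in print: the random-walk expansion (3.90)
with the kernel bounds of the local propagators), NOT a reading; an instance discharges it from its own kernel-form Theorem 3.1.
Everything else is as in `GpFrame`: block volumes `v` in the kernel pairing (p. 393), [4] Lemma 2.1 for the weight `v^{−1/2}`
(`Λvf`), and the L² writing `writeL2` for the members n = 0, 1, 2, 4 of `B9.pref6` ((3.46)₁,₂,₃,₅; the two-difference members ₄,₆ want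
the sibling frames over `B9Ineq346L2SecondDiffUniform` ∕ `B9Ineq346L2RightDiffUniform`). -/

/-- Profile bookkeeping: `c·p·e^{−δd} ≦ c′·p·e^{−δ′d}` for `c ≦ c′`, `0 ≦ c′`, `δ′ ≦ δ`, `p, d ≧ 0`. [folklore] -/
private theorem prof_le {c c' δ δ' d p : ℝ} (hp : 0 ≤ p) (hc : c ≤ c') (hc' : 0 ≤ c') (hδ : δ' ≤ δ) (hd : 0 ≤ d) :
    c * p * Real.exp (-(δ * d)) ≤ c' * p * Real.exp (-(δ' * d)) :=
  mul_le_mul (mul_le_mul_of_nonneg_right hc hp) (Real.exp_le_exp.2 (by nlinarith)) (Real.exp_nonneg _) (mul_nonneg hc' hp)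

variable (c35 geo bg Gp b κ S) in
/-- **THE LETTERS DICTIONARY FOR THE L² MEMBERS (3.46)₁,₂,₃,₅ OF G′** — `GpFrame` plus: the block-volume weights `v i` and the
kernel-pairing constant `cKv` of p. 393 with the block-volume comparison `hvol` and [4] Lemma 2.1 for `v^{−1/2}` (`hSTv`, `Λvf`,
`cv`) — the hypotheses of `B9Ineq346L2Uniform.thm34_Gp_l2_uniform` verbatim; ★ the NAMED LAW `ker31` = Theorem 3.1 (3.42)₁₋₄ for the
family's G′(U) IN THE PRINTED KERNEL FORM at (3.35)-regular U above the thresholds (frame-level constants `BK, δK`; N06 content,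
see the section note); and the L² writing `writeL2` (r06's conclusion (vii′) for the family's own G′(U′U) ⇒ the members
n ∈ {0,1,2,4} of the (3.46) block at U′U with (`wL B δ`, `wLδ δ`)).  A hypothesis structure; nothing asserted.
[cite: Balaban1985BackgroundPropagators, (3.46) p.398 + (3.42) p.397 + p.393 + p.398 remark + (3.65) p.402; Balaban1984PropagatorsII, (2.64)–(2.66) p.234 + Lemma 2.1 p.234] -/
structure L2Frame extends GpFrame c35 geo bg Gp b κ S where
  cv : ℝ
  cKv : ℝ
  BK : ℝ
  δK : ℝ
  Λvf : ℝ → ℝ → ℝ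
  wL : ℝ → ℝ → ℝ
  wLδ : ℝ → ℝ
  cv_nonneg : 0 ≤ cv
  cKv_pos : 0 < cKv
  BK_pos : 0 < BK
  δK_pos : 0 < δK
  Λvf_one_le : ∀ δ α : ℝ, 0 < δ → 0 < α → 1 ≤ Λvf δ α
  wL_pos : ∀ B δ : ℝ, 0 ≤ B → 0 < δ → 0 < wL B δ
  wLδ_pos : ∀ δ : ℝ, 0 < δ → 0 < wLδ δ
  v : ∀ i, (geo i).Site → ℝ
  v_pos : ∀ i (y : (geo i).Site), 0 < v i y
  hvol : ∀ i (y : (geo i).Site),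
    cKv * ((Finset.univ.filter (fun p : S i × ι => blk i p.1 = y)).card : ℝ) ≤ cv * v i y
  hSTv : ∀ i (δ α : ℝ), 0 < δ → 0 < α → ScaleTransfer (geo i) δ α (Λvf δ α) (fun y => (Real.sqrt (v i y))⁻¹)
  /-- ★ THE NAMED LAW (N06 content, NOT a reading): Theorem 3.1 (3.42)₁₋₄ for G′(U) in the printed KERNEL form, at regular U. -/
  ker31 : ∀ i (α₀ : ℝ) (U : (bg i).Cfg), MInv ≤ (geo i).M → 0 < α₀ → (geo i).M * α₀ ≤ aInv → (bg i).Reg335 c35 α₀ U →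
    B6RandomWalkKernel.HasKernelBound (g := toB6 (geo i) (Rr i) (Hp i)) (fun p : S i × ι => blk i p.1) (v i) cKv (Gop i U)
        (fun a a' => BK * (geo i).len a ^ 2 * Real.exp (-(δK * (geo i).dist a a'))) ∧
      (∀ k : κ ⊕ κ, B6RandomWalkKernel.HasKernelBound (g := toB6 (geo i) (Rr i) (Hp i)) (fun p : S i × ι => blk i p.1) (v i) cKv
        (conj b (diffLetter (T i) (coord i U) ((((geo i).eta : ℂ))⁻¹) k) * Gop i U)
        (fun a a' => BK * (geo i).len a * Real.exp (-(δK * (geo i).dist a a')))) ∧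
      (∀ l : κ ⊕ κ, B6RandomWalkKernel.HasKernelBound (g := toB6 (geo i) (Rr i) (Hp i)) (fun p : S i × ι => blk i p.1) (v i) cKv
        (Gop i U * conj b (diffLetter (T i) (coord i U) ((((geo i).eta : ℂ))⁻¹) l))
        (fun a a' => BK * (geo i).len a * Real.exp (-(δK * (geo i).dist a a')))) ∧
      (∀ k l : κ ⊕ κ, B6RandomWalkKernel.HasKernelBound (g := toB6 (geo i) (Rr i) (Hp i)) (fun p : S i × ι => blk i p.1) (v i) cKv
        (conj b (diffLetter (T i) (coord i U) ((((geo i).eta : ℂ))⁻¹) k) * Gop i U *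
          conj b (diffLetter (T i) (coord i U) ((((geo i).eta : ℂ))⁻¹) l))
        (fun a a' => BK * Real.exp (-(δK * (geo i).dist a a'))))
  /-- WRITING (3.46)₁,₂,₃,₅: r06's L² conclusion for the family's G′(U′U) at (B, 3δ/4) ⇒ the members n = 0, 1, 2, 4 at U′U. -/
  writeL2 : ∀ i (U U' : (bg i).Cfg) (α₁ B δ : ℝ), 0 < α₁ → α₁ ≤ aW → (bg i).Cplx337 α₁ U U' → 0 ≤ B → 0 < δ →
    (∀ (y y' : (geo i).Site) (hf μ : S i × ι → ℝ) (Hh : ℝ), 0 ≤ Hh → (∀ x, |hf x| ≤ Hh) → (∀ x, blk i x.1 ≠ y → hf x = 0) →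
      (∀ x, blk i x.1 ≠ y' → μ x = 0) →
      Real.sqrt (∑ x, (hf x * (Gop i ((bg i).mul U' U)) μ x) ^ 2) ≤
          B * Hh * (geo i).len y ^ 2 * Real.exp (-(3 / 4 * δ * (geo i).dist y y')) * Real.sqrt (∑ x, μ x ^ 2) ∧
        (∀ k : κ ⊕ κ, Real.sqrt (∑ x, (hf x * ((conj b (diffLetter (T i) (coord i U) ((((geo i).eta : ℂ))⁻¹) k)) *
            (Gop i ((bg i).mul U' U))) μ x) ^ 2) ≤
          B * Hh * (geo i).len y * Real.exp (-(3 / 4 * δ * (geo i).dist y y')) * Real.sqrt (∑ x, μ x ^ 2)) ∧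
        (∀ l : κ ⊕ κ, Real.sqrt (∑ x, (hf x * ((Gop i ((bg i).mul U' U)) *
            (conj b (diffLetter (T i) (coord i U) ((((geo i).eta : ℂ))⁻¹) l))) μ x) ^ 2) ≤
          B * Hh * (geo i).len y * Real.exp (-(3 / 4 * δ * (geo i).dist y y')) * Real.sqrt (∑ x, μ x ^ 2)) ∧
        (∀ k l : κ ⊕ κ, Real.sqrt (∑ x, (hf x * ((conj b (diffLetter (T i) (coord i U) ((((geo i).eta : ℂ))⁻¹) k)) *
            (Gop i ((bg i).mul U' U)) * (conj b (diffLetter (T i) (coord i U) ((((geo i).eta : ℂ))⁻¹) l))) μ x) ^ 2) ≤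
          B * Hh * Real.exp (-(3 / 4 * δ * (geo i).dist y y')) * Real.sqrt (∑ x, μ x ^ 2))) →
    ∀ n : Fin 6, n ≠ 3 → n ≠ 5 →
      ∀ (lam : (geo i).Loc) (h : (geo i).Cut) (y y' : (geo i).Site), (geo i).cutIn h y → (geo i).suppIn lam y' →
        (Gp i).l2 n ((bg i).mul U' U) lam h ≤
          wL B δ * B9.pref6 ((geo i).len y) n * (geo i).cutSup h * Real.exp (-(wLδ δ * (geo i).dist y y')) * (geo i).l2Norm lam

/-- ★ **THE (3.46)₁,₂,₃,₅-STEPS OF SECT. B FOR G′(U′U), INHABITED AT THE LETTERS GIVEN THE KERNEL-FORM LAW**: every `L2Frame`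
inhabits `B9SectBStepWhole.StepL2nPos d c35 geo bg Gp GA Cinv Gp n` for the members n = 0, 1, 2, 4.  Proof: r06's
`thm34_Gp_l2_uniform` at the common pair (max(cR·B₀, B_K), min(δ₀, δ_K)) of the read (3.42) majorants and the law's kernel letters
(both lowered to it), `gop_eq` ∘ `mul_law` to identify the family's G′(U′U) with r06's extension, then `writeL2`.  Honest scope: the
kernel-form input is the frame's law `ker31`, displayed — see the section note.
[cite: Balaban1985BackgroundPropagators, Thm 3.4 p.400 + (3.46) p.398 + p.398 remark + (3.65) p.402; Balaban1984PropagatorsII, (2.64)–(2.66) p.234 + Lemma 2.1 p.234] -/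
theorem stepL2nPos_of_l2Frame (F : L2Frame c35 geo bg Gp b κ S)
    (GA : ∀ i, B9.KernelFamily (geo i) (bg i)) (Cinv : ∀ i, B9.SiteKernel (geo i) (bg i))
    (n : Fin 6) (hn3 : n ≠ 3) (hn5 : n ≠ 5) :
    B9SectBStepWhole.StepL2nPos d c35 geo bg Gp GA Cinv Gp n := by
  intro B₀ δ₀ Bβ Bε Bεβ B₁ δ₁ hB₀ hδ₀ _ _
  have hB0 : 0 < F.cR * B₀ := mul_pos F.cR_pos hB₀
  have hBc : 0 < max (F.cR * B₀) F.BK := lt_max_of_lt_left hB0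
  have hδm : 0 < min δ₀ F.δK := lt_min hδ₀ F.δK_pos
  obtain ⟨a₁, ha₁, B, hB, H⟩ := B9Ineq346L2Uniform.thm34_Gp_l2_uniform b κ F.dB (min δ₀ F.δK) (max (F.cR * B₀) F.BK) F.Cq
    F.a₀ F.d₀ F.M₂ (F.Λf (min δ₀ F.δK)) (F.Λvf (min δ₀ F.δK)) F.cv hBc F.Cq_nonneg F.a₀_nonneg F.M₂_nonneg hδm
    (fun α hα => F.Λf_one_le _ α hδm hα) (fun α hα => F.Λvf_one_le _ α hδm hα) F.cv_nonneg F.hrepr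
  refine ⟨F.MInv, min a₁ F.aW, F.aInv, (F.wL B (min δ₀ F.δK), F.wLδ (min δ₀ F.δK)), F.MInv_pos, lt_min ha₁ F.aW_pos,
    F.aInv_pos, ⟨F.wL_pos B _ hB hδm, F.wLδ_pos _ hδm⟩, ?_⟩
  intro i hM α₀ hα₀ hMa U hU hT α₁ hα₁ ha U' hU' lam h y y' hcut hs
  obtain ⟨hΔG, hGΔ⟩ := F.reg_inv i α₀ U hM hα₀ hMa hU
  obtain ⟨h1, h2, h3, -⟩ := F.read342 i α₀ U B₀ δ₀ hM hα₀ hMa hU hB₀ hδ₀ hT.1.1.1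
  obtain ⟨k1, k2, k3, k4⟩ := F.ker31 i α₀ U hM hα₀ hMa hU
  obtain ⟨hkF, hsF, h337s, h337F, h337B, hA, hAτ⟩ := F.cplx i α₁ U U' hα₁ hU'
  -- lowering the read majorants (cR·B₀, δ₀) and the kernel letters (B_K, δ_K) to the common pair
  have hcle : F.cR * B₀ ≤ max (F.cR * B₀) F.BK := le_max_left _ _
  have hKle : F.BK ≤ max (F.cR * B₀) F.BK := le_max_right _ _
  have h1' := hasMajorant_mono (g := toB6 (geo i) (F.Rr i) (F.Hp i)) (fun p : S i × ι => F.blk i p.1) h1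
    (K' := fun a a' => max (F.cR * B₀) F.BK * (geo i).len a ^ 2 * Real.exp (-(min δ₀ F.δK * (geo i).dist a a')))
    fun (a a' : (geo i).Site) => prof_le (sq_nonneg ((geo i).len a)) hcle hBc.le (min_le_left δ₀ F.δK) (F.dist_nonneg i a a')
  have h2' := fun k => hasMajorant_mono (g := toB6 (geo i) (F.Rr i) (F.Hp i)) (fun p : S i × ι => F.blk i p.1) (h2 k)
    (K' := fun a a' => max (F.cR * B₀) F.BK * (geo i).len a * Real.exp (-(min δ₀ F.δK * (geo i).dist a a')))
    fun (a a' : (geo i).Site) => prof_le (F.len_pos i a).le hcle hBc.le (min_le_left δ₀ F.δK) (F.dist_nonneg i a a')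
  have h3' := fun k => hasMajorant_mono (g := toB6 (geo i) (F.Rr i) (F.Hp i)) (fun p : S i × ι => F.blk i p.1) (h3 k)
    (K' := fun a a' => max (F.cR * B₀) F.BK * (geo i).len a * Real.exp (-(min δ₀ F.δK * (geo i).dist a a')))
    fun (a a' : (geo i).Site) => prof_le (F.len_pos i a).le hcle hBc.le (min_le_left δ₀ F.δK) (F.dist_nonneg i a a')
  have k1' := B6RandomWalkKernel.hasKernelBound_mono (g := toB6 (geo i) (F.Rr i) (F.Hp i)) (fun p : S i × ι => F.blk i p.1) (F.v_pos i) k1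
    (K' := fun a a' => max (F.cR * B₀) F.BK * (geo i).len a ^ 2 * Real.exp (-(min δ₀ F.δK * (geo i).dist a a')))
    fun (a a' : (geo i).Site) => prof_le (sq_nonneg ((geo i).len a)) hKle hBc.le (min_le_right δ₀ F.δK) (F.dist_nonneg i a a')
  have k2' := fun k => B6RandomWalkKernel.hasKernelBound_mono (g := toB6 (geo i) (F.Rr i) (F.Hp i)) (fun p : S i × ι => F.blk i p.1) (F.v_pos i) (k2 k)
    (K' := fun a a' => max (F.cR * B₀) F.BK * (geo i).len a * Real.exp (-(min δ₀ F.δK * (geo i).dist a a')))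
    fun (a a' : (geo i).Site) => prof_le (F.len_pos i a).le hKle hBc.le (min_le_right δ₀ F.δK) (F.dist_nonneg i a a')
  have k3' := fun l => B6RandomWalkKernel.hasKernelBound_mono (g := toB6 (geo i) (F.Rr i) (F.Hp i)) (fun p : S i × ι => F.blk i p.1) (F.v_pos i) (k3 l)
    (K' := fun a a' => max (F.cR * B₀) F.BK * (geo i).len a * Real.exp (-(min δ₀ F.δK * (geo i).dist a a')))
    fun (a a' : (geo i).Site) => prof_le (F.len_pos i a).le hKle hBc.le (min_le_right δ₀ F.δK) (F.dist_nonneg i a a')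
  have k4' := fun k l => B6RandomWalkKernel.hasKernelBound_mono (g := toB6 (geo i) (F.Rr i) (F.Hp i)) (fun p : S i × ι => F.blk i p.1) (F.v_pos i) (k4 k l)
    (K' := fun a a' => max (F.cR * B₀) F.BK * Real.exp (-(min δ₀ F.δK * (geo i).dist a a')))
    fun (a a' : (geo i).Site) => by
      have h := prof_le (p := 1) zero_le_one hKle hBc.le (min_le_right δ₀ F.δK) (F.dist_nonneg i a a')
      simpa only [mul_one] using h
  obtain ⟨hinv1, hinv2, hL2⟩ := H (F.T i) (F.coord i U) (F.blk i) (F.kQ i U) (F.sQ i U) (F.cfun i) (F.w i U)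
    (F.dist_nonneg i) (F.triangle i) (F.dist_self i) (F.dist_comm i) (F.len_pos i) (F.eta_le_len i) (F.eta_pos i)
    (fun α hα hα1 => F.h261 i _ α hδm hα hα1) (fun α hα => F.hST i _ α hδm hα) (F.unitary i U)
    (F.stencilB i) (F.stencilF i) (F.stencil0 i) (F.w_nonneg i U) (F.card_w i U) (F.hkQ i U) (F.hsQ i U) (F.hcfun i)
    hΔG hGΔ h1' h2' h3' (F.v_pos i) F.cKv_pos k1' k2' k3' k4' (F.hvol i) (fun α hα => F.hSTv i _ α hδm hα)
    α₁ hα₁.le (le_trans ha (min_le_left _ _)) (F.expA i U U') (F.kF i U U') (F.sF i U U')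
    hkF hsF h337s h337F h337B hA hAτ
  have hG := F.gop_eq i ((bg i).mul U' U) _ _ (F.mul_law i α₁ U U' hα₁ hU') hinv1 hinv2
  rw [← hG] at hL2
  exact F.writeL2 i U U' α₁ B (min δ₀ F.δK) hα₁ (le_trans ha (min_le_right _ _)) hU' hB hδm hL2 n hn3 hn5
    lam h y y' hcut hs

end Literature.MathematicalPhysics.QuantumFieldTheory.Balaban1983to89.B9SectBGpStepAtLetters
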